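import Literature.MathematicalPhysics.QuantumFieldTheory.Balaban1983to89.B6Prop22DerivTwoLevelBox
import Literature.MathematicalPhysics.QuantumFieldTheory.Balaban1983to89.B6Ineq243HolderTwoLevelBox

/-!
# `Balaban1983to89.B6Prop22HolderTwoLevelBox` — [B6] Proposition 2.2, FOURTH ENTRY of (2.67), the HÖLDER NORM OF THE
DERIVATIVE `‖ζ∇G′λ‖_α ≤ O(1)(L^jη)^{1−α}(‖ζ‖_α + |ζ|)e^{−½δ₀d(y,y′)}|λ|` («(L^jη)² replaced by (L^jη)^{1−α}»), FOR THE
GENUINE TWO-LEVEL OPERATOR `Δ_Ω^{L^{−j},N} + m² + Q′*aQ′` ON A BOX OF `L`-BLOCKS, ALONG THE PRINTED ROUTE — uniformly in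
the mesh and the volume (file 10 of the two-level parametrix; nothing existing is touched; no fact is minted)

FRAMING (verbatim cell line):
statement-level skeleton of published theorems with citation tags; proofs where landed; nothing here is a claim about the Yang–Mills mass gap

Source under audit (cell pub-balaban): T. Bałaban, *Propagators and renormalization transformations for lattice gauge
theories. II*, Commun. Math. Phys. **96** (1984) 223–250 [`Balaban1984PropagatorsII`, "B6"], p. 234 [PDF 12] Proposition
2.2 (2.64)–(2.67) (render `b2b-balaban-ref1/pages/1984-cmp96-propagators-rt-II/…-p012-x2.png`, read as an image this
generation), p. 229–230 [PDF 7–8] (2.36)–(2.38), (2.42)–(2.43); [3] = T. Bałaban, *Regularity and decay of lattice Green's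
functions*, Commun. Math. Phys. **89** (1983) 571–597 [`Balaban1983RegularityDecay`, "B4"], p. 573 Theorem (1.9), §2
pp. 575–577 (the cubes `□_j`, (2.6), «|∂^ηh_j| ≤ O(M⁻¹), |Δ^ηh_j| ≤ O(M⁻²)»).

## WHAT IS PRINTED (p. 234, verbatim up to notation)

«… |(G′λ)(x)| ≤ Σ_{n=0}^∞ |(G′₀Rⁿλ)(x)| ≤ O(1)(L^jη)² e^{−½δ₀d(y,y′)}|λ|. (2.66)  The similar inequalities hold for a
derivative of G′λ and for a Hölder norm of a derivative, but with (L^jη)² replaced by L^jη and (L^jη)^{1−α}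
correspondingly. Let us formulate these results in Proposition 2.2. If we have (2.1), (2.2) and M is sufficiently large,
then the operator G′ = Δ′_a^{−1}(a = 1) satisfies the inequalities |(G′λ)(x)|, |(∇G′λ)(x)|, |(G′∇*λ)(x)|, ‖ζ∇G′λ‖_α,
‖ζG′∇*λ‖_α, |(ΔG′λ)(x)| ≤ O(1)[(L^jη)², L^jη, L^jη, (L^jη)^{1−α}(‖ζ‖_α + |ζ|), (L^jη)^{1−α}(‖ζ‖_α + |ζ|), 1]·
e^{−½δ₀d(y,y′)}|λ|, x ∈ B^j(y) or supp ζ ⊂ B^j(y), y ∈ Λ_j, supp λ ⊂ B^{j′}(y′), y′ ∈ Λ_{j′}. (2.67)»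

## WHAT THIS FILE CERTIFIES (kernel-checked; `A = 0`; the lineage is USED, not re-proved)

Setting of `B6Prop22TwoLevelBox` / `B6Prop22DerivTwoLevelBox` (`n = L^k` fine sites per unit length, `ξ = 1/n`, `Ω` the
box of `L`-blocks `Π_μ[0, LM_hP_μ)`, `E = twoLevelOp`, `G′ = gTwoLevel = E^{−1}`, the printed cut-offs `h_q` of (2.36) on
the cut cubes `□_q` of side `2M = 2LM_h`, `G′₀ = Σ_q h_qG′(□_q)h_q`, `R` of (2.38)).  THE FOURTH ENTRY of (2.67), in the
two-centre weighted form of [3] (1.9) used by `B4Thm19ZeroBoxHolder` (Hölder weight `(n/|x′−x|_∞)^α = (ξ|x′−x|_∞)^{−α}`,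
difference quotient `n(φ(x+e_μ) − φ(x)) = (∂^ξ_μφ)(x)`, weight `e^{δ·min(|x−z|,|x′−z|)/n}` — `min = dist({x,x′}, z)`):

* `wsum2_gZero_holder_le` — THE (2.64)-INPUT: the Hölder-weighted doubly differenced rows of `G′₀` have two-centre
  functional `≤ C₀`, uniformly (far pairs `|x′−x| ≥ n`: twice the differenced bound; near pairs: the four-term product
  rule for `dd(h_q(·)G′(□_q)(·,z))` — `dd h_q = O(s/N²)` (`abs_hq_dd_le`), `(h_q(x′)−h_q(x))∂G′(□_q) = O(s/N)·(2.43)₂`,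
  `∂h_q·(long difference of G′(□_q)) = O(1/N)·O(s)` derivative bounds (`wsum_longDiff_le`, telescoping along a monotone
  lattice path), `h_q·ddG′(□_q)` = the cube Hölder clause `B6Ineq243HolderTwoLevelBox.ineq243_twoLevel_holder_wsum2` — the
  four points lying in `□_q` by the margin `exists_emb_eq_of_near` of `supp h_q` inside its cube, at most `4·2^{d+1}`
  cubes meeting them);
* `prop22_entry4_twoLevelBox` — THE FOURTH ENTRY: `sup (n/|x′−x|)^α Σ_z|n·ddG′(z)|e^{δmin(…)/n} ≤ C` for `L·M_h ≥ M₀`, from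
  the doubly differenced fixed point `ddG′ = ddG′₀ + (ddG′)R` (`B6Prop22TwoLevelBox.gTwoLevel_eq_gZero_add`), the
  (2.51)/(2.65)-input `B6Prop22TwoLevelBox.roww_rOp_le` (`sup roww(R) ≤ C_R/M ≤ ½`) and
  `B6Ineq243HolderTwoLevelBox.wsum2_vecMul_le`;
* `gTwoLevel_holder_value_decay` — the printed form `(ξ|x′−x|)^{−α}|((∂^ξ_μG′λ)(x′) − (∂^ξ_μG′λ)(x))| ≤ Ce^{−δξD}‖λ‖_∞`,
  `ξD ≤ dist({x,x′}, supp λ)`.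

HONEST SCOPE (as for the whole chain): the `k = 1` geometry of the parametrix (two levels `j, j+1`), `A = 0`, a Neumann BOX
`Ω` for the torus, ONE cube size, the printed cut-offs; the cut-off `ζ` and the factor `(‖ζ‖_α + |ζ|)` of the print are
dispensed with exactly as in [3] (1.9) for parallelepipeds («the inequalities hold without any restrictions on the points
x, x′», p. 573), the Hölder quotient being taken directly between any two points of `Ω`; constants existential (functions
of `d`, `L`, `α`, the windows).  As a BOUND the entry also follows from the cube-level clause on `Ω` itself — certified
here is the printed ROUTE (2.36)→(2.38)→(2.43)→(2.64)→(2.66)/(2.67).  The fifth entry `‖ζG′∇*λ‖_α` is NOT treated (it needs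
the Hölder continuity of `∂G(□)` in the second variable, which the tree's [3] files do not state).

Value = kernel certificate of the fourth entry of (2.67) for the genuine two-level box operator at `A = 0`, uniformly in
the mesh; NOT summit progress (the Yang–Mills statements are untouched).
-/

namespace Literature.MathematicalPhysics.QuantumFieldTheory.Balaban1983to89.B6Prop22HolderTwoLevelBox

open Finset Matrix
open scoped ContDiff
open Literature.MathematicalPhysics.QuantumFieldTheory.Balaban1983to89.B4Reflection242 (boxDom mem_boxDom nbrs mem_nbrs)
open Literature.MathematicalPhysics.QuantumFieldTheory.Balaban1983to89.B4ContourShift (supNorm supNorm_nonneg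
  abs_le_supNorm exists_supNorm_eq)
open Literature.MathematicalPhysics.QuantumFieldTheory.Balaban1983to89.B4Lemma22ReduceZero (Box)
open Literature.MathematicalPhysics.QuantumFieldTheory.Balaban1983to89.B4Thm110ZeroBox (roww roww_nonneg roww_add_le
  supNorm_sub_le_sub_add_sub)
open Literature.MathematicalPhysics.QuantumFieldTheory.Balaban1983to89.B4Thm110ZeroBoxDeriv (wsum wsum_nonneg wsum_add_le
  wsum_mul_left supNorm_single_le)
open Literature.MathematicalPhysics.QuantumFieldTheory.Balaban1983to89.B4Thm19ZeroBoxHolder (wsum2 wsum2_nonneg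
  wsum2_add_le wsum2_mul_left wsum2_le_wsum_left wsum2_le_wsum_right wsum2_split_le wsum2_mono_rate
  abs_sum_mul_le_of_wsum2 mulVec_dd rpow_le_self_of_one_le)
open Literature.MathematicalPhysics.QuantumFieldTheory.Balaban1983to89.B4PartitionUnity22 (hprof hCube D1 D2 D1_nonneg
  D2_nonneg contDiff_hprof hasCompactSupport_hprof hprof_nonneg hprof_le_one abs_sub_le_D1 abs_deriv2_le_D2)
open Literature.MathematicalPhysics.QuantumFieldTheory.Balaban1983to89.B4SubBoxCarrier (inSub inSub_iff)
open Literature.MathematicalPhysics.QuantumFieldTheory.Balaban1983to89.B6Ineq243TwoLevelBox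
open Literature.MathematicalPhysics.QuantumFieldTheory.Balaban1983to89.B6Partition236TwoLevelBox
open Literature.MathematicalPhysics.QuantumFieldTheory.Balaban1983to89.B6Eq238TwoLevelBox
open Literature.MathematicalPhysics.QuantumFieldTheory.Balaban1983to89.B6Ineq249TwoLevelBox
open Literature.MathematicalPhysics.QuantumFieldTheory.Balaban1983to89.B6Prop22TwoLevelBox
open Literature.MathematicalPhysics.QuantumFieldTheory.Balaban1983to89.B6Prop22DerivTwoLevelBox
open Literature.MathematicalPhysics.QuantumFieldTheory.Balaban1983to89.B6Ineq243HolderTwoLevelBox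

noncomputable section

variable {d : ℕ}

/-! ## §1 Bookkeeping: the weighted functionals, the overlap count, telescoping along a monotone lattice path -/

section Tools

variable {N : Fin (d + 1) → ℕ}

/-- `wsum2` depends only on the function. [folklore] -/
private theorem wsum2_congr (δ : ℝ) (n : ℕ) (x x' : ↥(boxDom N)) {g g' : ↥(boxDom N) → ℝ}
    (h : ∀ z, g z = g' z) : wsum2 δ n x x' g = wsum2 δ n x x' g' := by
  unfold wsum2
  exact Finset.sum_congr rfl fun z _ => by rw [h z]

/-- `wsum2` of a finite sum of functions. [folklore] -/
private theorem wsum2_sum_le {ι : Type*} (s : Finset ι) (δ : ℝ) (n : ℕ) (x x' : ↥(boxDom N))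
    (g : ι → ↥(boxDom N) → ℝ) : wsum2 δ n x x' (fun z => ∑ i ∈ s, g i z) ≤ ∑ i ∈ s, wsum2 δ n x x' (g i) := by
  classical
  induction s using Finset.induction_on with
  | empty =>
      simp only [Finset.sum_empty]
      unfold wsum2
      simp
  | insert i s hi ih =>
      rw [Finset.sum_insert hi]
      have e : (fun z => ∑ j ∈ insert i s, g j z) = fun z => g i z + ∑ j ∈ s, g j z :=
        funext fun z => Finset.sum_insert hi
      rw [e]
      exact (wsum2_add_le δ n x x' _ _).trans (by linarith)

/-- comparison: `|g| ≤ c|g′|` pointwise gives `wsum2(g) ≤ c·wsum2(g′)`. [folklore] -/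
private theorem wsum2_le_mul_of_abs_le (δ : ℝ) (n : ℕ) (x x' : ↥(boxDom N)) {g g' : ↥(boxDom N) → ℝ} {c : ℝ}
    (h : ∀ z, |g z| ≤ c * |g' z|) : wsum2 δ n x x' g ≤ c * wsum2 δ n x x' g' := by
  unfold wsum2
  rw [Finset.mul_sum]
  refine Finset.sum_le_sum fun z _ => ?_
  rw [← mul_assoc]
  exact mul_le_mul_of_nonneg_right (h z) (Real.exp_pos _).le

/-- comparison: `|g| ≤ c|g′|` pointwise gives `wsum(g) ≤ c·wsum(g′)`. [folklore] -/
private theorem wsum_le_mul_of_abs_le (δ : ℝ) (n : ℕ) (x : ↥(boxDom N)) {g g' : ↥(boxDom N) → ℝ} {c : ℝ}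
    (h : ∀ z, |g z| ≤ c * |g' z|) : wsum δ n x g ≤ c * wsum δ n x g' := by
  unfold wsum
  rw [Finset.mul_sum]
  refine Finset.sum_le_sum fun z _ => ?_
  rw [← mul_assoc]
  exact mul_le_mul_of_nonneg_right (h z) (Real.exp_pos _).le

/-- shifting the base point by `≤ r` costs a factor `e^{δr/n}` (`δ ≥ 0`). [folklore] -/
private theorem wsum_shift_le {δ : ℝ} (hδ : 0 ≤ δ) (n : ℕ) (x y : ↥(boxDom N)) {r : ℝ}
    (hxy : supNorm (x.1 - y.1) ≤ r) (g : ↥(boxDom N) → ℝ) :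
    wsum δ n x g ≤ Real.exp (δ * r / n) * wsum δ n y g := by
  unfold wsum
  rw [Finset.mul_sum]
  refine Finset.sum_le_sum fun z _ => ?_
  rw [mul_left_comm]
  refine mul_le_mul_of_nonneg_left ?_ (abs_nonneg _)
  rw [← Real.exp_add]
  apply Real.exp_le_exp.2
  rw [← add_div, ← mul_add]
  refine div_le_div_of_nonneg_right (mul_le_mul_of_nonneg_left ?_ hδ) (Nat.cast_nonneg n)
  exact (supNorm_sub_le_sub_add_sub x.1 y.1 z.1).trans (by linarith)

/-- `e^{δr/n} ≤ e^{δ}` for `r ≤ n` (`δ ≥ 0`, `n ≥ 1`). [folklore] -/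
private theorem exp_rate_le {δ r : ℝ} (hδ : 0 ≤ δ) {n : ℕ} (hn : 1 ≤ n) (hr : r ≤ (n : ℝ)) :
    Real.exp (δ * r / n) ≤ Real.exp δ := by
  have hn' : (0 : ℝ) < n := by exact_mod_cast hn
  apply Real.exp_le_exp.2
  rw [div_le_iff₀ hn']
  exact mul_le_mul_of_nonneg_left hr hδ

/-- a sum of non-negative terms, each `≤ B`, non-zero only on terms indexed injectively by `T`: `≤ |T|·B`. [folklore] -/
private theorem sum_le_card_mul₄ {ι σ : Type*} [Fintype ι] [DecidableEq σ] (f : ι → ℝ) (key : ι → σ)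
    (hkey : Function.Injective key) (T : Finset σ) (hT : ∀ i, f i ≠ 0 → key i ∈ T) {B : ℝ} (hB : 0 ≤ B)
    (hf : ∀ i, f i ≤ B) : ∑ i, f i ≤ T.card * B := by
  classical
  rw [← Finset.sum_filter_ne_zero]
  have hcard : (Finset.univ.filter fun i => f i ≠ 0).card ≤ T.card :=
    Finset.card_le_card_of_injOn key (fun i hi => by
      rw [Finset.coe_filter] at hi; exact hT i hi.2) (fun i _ j _ h => hkey h)
  calc ∑ i ∈ Finset.univ.filter (fun i => f i ≠ 0), f i
      ≤ (Finset.univ.filter fun i => f i ≠ 0).card • B := Finset.sum_le_card_nsmul _ _ _ fun i _ => hf i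
    _ = ((Finset.univ.filter fun i => f i ≠ 0).card : ℝ) * B := by rw [nsmul_eq_mul]
    _ ≤ T.card * B := by gcongr

/-- **TELESCOPING ALONG A MONOTONE LATTICE PATH** (the discrete mean-value device «a difference over distance `s` is a sum
of `≤ (d+1)s` nearest-neighbour differences»): a symmetric, subadditive functional `Φ` of pairs of box points that is
`≤ B` on nearest-neighbour pairs of the order interval `[lo, hi]` is `≤ m·B` on every pair of the interval at
`ℓ¹`-distance `≤ m`. [folklore] -/
private theorem tele_le {N' : Fin (d + 1) → ℕ} (Φ : ↥(boxDom N') → ↥(boxDom N') → ℝ)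
    (hsymm : ∀ a b, Φ a b = Φ b a) (htri : ∀ a b c, Φ a c ≤ Φ a b + Φ b c) (hzero : ∀ a, Φ a a = 0)
    (lo hi : Fin (d + 1) → ℤ) {B : ℝ} (hB0 : 0 ≤ B)
    (hB : ∀ (i : Fin (d + 1)) (u ue : ↥(boxDom N')), ue.1 = u.1 + Pi.single i 1 →
      (∀ j, lo j ≤ u.1 j) → (∀ j, ue.1 j ≤ hi j) → Φ u ue ≤ B) :
    ∀ (m : ℕ) (a b : ↥(boxDom N')), (∀ j, lo j ≤ a.1 j ∧ a.1 j ≤ hi j) → (∀ j, lo j ≤ b.1 j ∧ b.1 j ≤ hi j) →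
      ∑ j, |b.1 j - a.1 j| ≤ (m : ℤ) → Φ a b ≤ m * B := by
  intro m
  induction m with
  | zero =>
      intro a b ha hb hab
      have h0 : ∑ j, |b.1 j - a.1 j| = 0 :=
        le_antisymm (by exact_mod_cast hab) (Finset.sum_nonneg fun j _ => abs_nonneg _)
      have hba : b = a := by
        apply Subtype.ext
        funext j
        have := (Finset.sum_eq_zero_iff_of_nonneg fun j _ => abs_nonneg (b.1 j - a.1 j)).1 h0 j (Finset.mem_univ _)
        have := abs_eq_zero.1 this
        linarith
      rw [hba, hzero]
      simp
  | succ m ih =>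
      intro a b ha hb hab
      by_cases heq : b = a
      · rw [heq, hzero]; positivity
      · have hex : ∃ i, a.1 i ≠ b.1 i := by
          by_contra hall
          push Not at hall
          exact heq (Subtype.ext (funext fun j => (hall j).symm))
        obtain ⟨i, hine⟩ := hex
        have haB := mem_boxDom.1 a.2
        have hbB := mem_boxDom.1 b.2
        rcases lt_or_gt_of_ne hine with hlt | hgt
        · -- step up in direction `i`
          have hmem : a.1 + Pi.single i 1 ∈ boxDom N' := by
            rw [mem_boxDom]
            intro j
            by_cases hj : j = i
            · subst hj
              simp only [Pi.add_apply, Pi.single_eq_same]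
              have := haB j; have := hbB j
              constructor <;> omega
            · simp only [Pi.add_apply, Pi.single_eq_of_ne hj, add_zero]
              exact haB j
          obtain ⟨a₁, ha₁def⟩ : ∃ a₁ : ↥(boxDom N'), a₁ = ⟨a.1 + Pi.single i 1, hmem⟩ := ⟨_, rfl⟩
          have ha₁v : ∀ j, a₁.1 j = a.1 j + (Pi.single i (1 : ℤ) : Fin (d + 1) → ℤ) j := fun j => by
            rw [ha₁def]; rfl
          have ha₁ : ∀ j, lo j ≤ a₁.1 j ∧ a₁.1 j ≤ hi j := by
            intro j
            rw [ha₁v j]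
            by_cases hj : j = i
            · subst hj
              rw [Pi.single_eq_same]
              have := (ha j).1; have := (hb j).2
              constructor <;> omega
            · rw [Pi.single_eq_of_ne hj, add_zero]
              exact ha j
          have hsum : ∑ j, |b.1 j - a₁.1 j| ≤ (m : ℤ) := by
            have e : ∀ j, |b.1 j - a₁.1 j| = |b.1 j - a.1 j| - (Pi.single i (1 : ℤ) : Fin (d + 1) → ℤ) j := by
              intro j
              rw [ha₁v j]
              by_cases hj : j = i
              · subst hj
                rw [Pi.single_eq_same, abs_of_nonneg (by omega), abs_of_nonneg (by omega)]
                ring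
              · rw [Pi.single_eq_of_ne hj, add_zero, sub_zero]
            rw [Finset.sum_congr rfl fun j _ => e j, Finset.sum_sub_distrib, Finset.sum_pi_single',
              if_pos (Finset.mem_univ _)]
            push_cast at hab
            omega
          have h1 : Φ a a₁ ≤ B := hB i a a₁ (funext fun j => ha₁v j) (fun j => (ha j).1) (fun j => (ha₁ j).2)
          have h2 : Φ a₁ b ≤ m * B := ih a₁ b ha₁ hb hsum
          calc Φ a b ≤ Φ a a₁ + Φ a₁ b := htri _ _ _
            _ ≤ B + m * B := add_le_add h1 h2
            _ = ((m + 1 : ℕ) : ℝ) * B := by push_cast; ring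
        · -- step down in direction `i`
          have hmem : a.1 - Pi.single i 1 ∈ boxDom N' := by
            rw [mem_boxDom]
            intro j
            by_cases hj : j = i
            · subst hj
              simp only [Pi.sub_apply, Pi.single_eq_same]
              have := haB j; have := hbB j
              constructor <;> omega
            · simp only [Pi.sub_apply, Pi.single_eq_of_ne hj, sub_zero]
              exact haB j
          obtain ⟨a₁, ha₁def⟩ : ∃ a₁ : ↥(boxDom N'), a₁ = ⟨a.1 - Pi.single i 1, hmem⟩ := ⟨_, rfl⟩
          have ha₁v : ∀ j, a₁.1 j = a.1 j - (Pi.single i (1 : ℤ) : Fin (d + 1) → ℤ) j := fun j => by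
            rw [ha₁def]; rfl
          have ha₁ : ∀ j, lo j ≤ a₁.1 j ∧ a₁.1 j ≤ hi j := by
            intro j
            rw [ha₁v j]
            by_cases hj : j = i
            · subst hj
              rw [Pi.single_eq_same]
              have := (ha j).2; have := (hb j).1
              constructor <;> omega
            · rw [Pi.single_eq_of_ne hj, sub_zero]
              exact ha j
          have hsum : ∑ j, |b.1 j - a₁.1 j| ≤ (m : ℤ) := by
            have e : ∀ j, |b.1 j - a₁.1 j| = |b.1 j - a.1 j| - (Pi.single i (1 : ℤ) : Fin (d + 1) → ℤ) j := by
              intro j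
              rw [ha₁v j]
              by_cases hj : j = i
              · subst hj
                rw [Pi.single_eq_same, abs_of_nonpos (by omega), abs_of_nonpos (by omega)]
                ring
              · rw [Pi.single_eq_of_ne hj, sub_zero, sub_zero]
            rw [Finset.sum_congr rfl fun j _ => e j, Finset.sum_sub_distrib, Finset.sum_pi_single',
              if_pos (Finset.mem_univ _)]
            push_cast at hab
            omega
          have hae : a.1 = a₁.1 + Pi.single i 1 := by
            funext j; rw [Pi.add_apply, ha₁v j]; ring
          have h1 : Φ a a₁ ≤ B := by
            rw [hsymm]
            exact hB i a₁ a hae (fun j => (ha₁ j).1) (fun j => (ha j).2)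
          have h2 : Φ a₁ b ≤ m * B := ih a₁ b ha₁ hb hsum
          calc Φ a b ≤ Φ a a₁ + Φ a₁ b := htri _ _ _
            _ ≤ B + m * B := add_le_add h1 h2
            _ = ((m + 1 : ℕ) : ℝ) * B := by push_cast; ring

/-- **THE LONG DIFFERENCE OF TWO ROWS AS A SUM OF NEAREST-NEIGHBOUR DIFFERENCES**: if every nearest-neighbour differenced
row inside the order interval spanned by `a, b` has `w`-weighted `ℓ¹` size `≤ B` (`w ≥ 0` a fixed weight), then
`Σ_c |T(b,c) − T(a,c)|·w(c) ≤ (d+1)|b − a|_∞·B`. [folklore] -/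
private theorem rowDiff_tele_le {N' : Fin (d + 1) → ℕ} (T : Matrix ↥(boxDom N') ↥(boxDom N') ℝ)
    (w : ↥(boxDom N') → ℝ) (hw : ∀ c, 0 ≤ w c) (a b : ↥(boxDom N')) {B : ℝ} (hB0 : 0 ≤ B)
    (hB : ∀ (i : Fin (d + 1)) (u ue : ↥(boxDom N')), ue.1 = u.1 + Pi.single i 1 →
      (∀ j, min (a.1 j) (b.1 j) ≤ u.1 j) → (∀ j, ue.1 j ≤ max (a.1 j) (b.1 j)) →
      ∑ c, |T ue c - T u c| * w c ≤ B) :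
    ∑ c, |T b c - T a c| * w c ≤ (d + 1) * supNorm (b.1 - a.1) * B := by
  have hl1 : 0 ≤ ∑ j, |b.1 j - a.1 j| := Finset.sum_nonneg fun j _ => abs_nonneg _
  obtain ⟨m, hm⟩ : ∃ m : ℕ, (m : ℤ) = ∑ j, |b.1 j - a.1 j| := ⟨(∑ j, |b.1 j - a.1 j|).toNat, Int.toNat_of_nonneg hl1⟩
  have h := tele_le (fun u v : ↥(boxDom N') => ∑ c, |T v c - T u c| * w c)
    (fun u v => Finset.sum_congr rfl fun c _ => by rw [abs_sub_comm])
    (fun u v v' => by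
      rw [← Finset.sum_add_distrib]
      refine Finset.sum_le_sum fun c _ => ?_
      rw [← add_mul]
      refine mul_le_mul_of_nonneg_right ?_ (hw c)
      calc |T v' c - T u c| = |(T v c - T u c) + (T v' c - T v c)| := by ring_nf
        _ ≤ |T v c - T u c| + |T v' c - T v c| := abs_add_le _ _)
    (fun u => by simp)
    (fun j => min (a.1 j) (b.1 j)) (fun j => max (a.1 j) (b.1 j)) hB0 hB m a b
    (fun j => ⟨min_le_left _ _, le_max_left _ _⟩) (fun j => ⟨min_le_right _ _, le_max_right _ _⟩) hm.symm.le
  refine h.trans (mul_le_mul_of_nonneg_right ?_ hB0)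
  have : (m : ℝ) = ∑ j, (((|b.1 j - a.1 j| : ℤ)) : ℝ) := by
    have := congrArg (fun z : ℤ => (z : ℝ)) hm
    push_cast at this ⊢
    exact this
  rw [this]
  calc ∑ j, (((|b.1 j - a.1 j| : ℤ)) : ℝ) ≤ ∑ _j : Fin (d + 1), supNorm (b.1 - a.1) :=
        Finset.sum_le_sum fun j _ => abs_le_supNorm (b.1 - a.1) j
    _ = (d + 1) * supNorm (b.1 - a.1) := by
        rw [Finset.sum_const, Finset.card_univ, Fintype.card_fin, nsmul_eq_mul]
        push_cast
        ring

end Tools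

/-! ## §2 Geometry: the margin of `supp h_q` inside the cut cube `□_q` -/

section Geometry

variable {ℓ k Mh : ℕ} {P : Fin (d + 1) → ℕ} {q : Fin (d + 1) → ℤ}

/-- **THE MARGIN OF THE CUT-OFF INSIDE ITS CUBE**: a site of `Ω` within `2n` fine sites (two unit lengths, `n = L^k`) of a
site carrying `h_q` lies in the cut cube `□_q` — the support radius `⅝N` of `h_q` plus `2n ≤ N/3` stays below the
half-width `N = nLM_h` of the cube (`LM_h ≥ 6`, `N ≥ 12`); the faces of `Ω` are faces of the cut cube.
[cite: Balaban1984PropagatorsI, (1.118) p.36 («h ∈ C₀^∞(]−⅔,⅔[)»); Balaban1983RegularityDecay, §2 p.575, (2.6) p.576] -/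
theorem exists_emb_eq_of_near (hℓ : 1 ≤ ℓ) (hk : 1 ≤ k) (hMh : 3 ≤ Mh) (hP : ∀ i, 1 ≤ P i) (hq : q ∈ ctrs P)
    {x p : ↥(Box d ℓ k (fun i => (ℓ + 1) * (Mh * P i)))} (hx : hΩ ℓ k Mh P q x ≠ 0)
    (hp : supNorm (p.1 - x.1) ≤ 2 * (((ℓ + 1) ^ k : ℕ) : ℝ)) : ∃ b, emb ℓ k Mh P q hP hq b = p := by
  rw [emb, ← inSub_iff]
  set N : ℕ := (ℓ + 1) ^ k * ((ℓ + 1) * Mh) with hNdef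
  have hn2 : 2 ≤ (ℓ + 1) ^ k := by
    calc 2 = 2 ^ 1 := by norm_num
      _ ≤ (ℓ + 1) ^ 1 := Nat.pow_le_pow_left (by omega) 1
      _ ≤ (ℓ + 1) ^ k := Nat.pow_le_pow_right (by omega) hk
  have hLM : 6 ≤ (ℓ + 1) * Mh := by nlinarith
  have hN6 : 6 * (ℓ + 1) ^ k ≤ N := by
    rw [hNdef, Nat.mul_comm 6]
    exact Nat.mul_le_mul_left _ hLM
  have hN12 : 12 ≤ N := by nlinarith
  have hN1 : 1 ≤ N := le_trans (by norm_num) hN12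
  have hNr : (12 : ℝ) ≤ (N : ℝ) := by exact_mod_cast hN12
  have hN6r : 6 * (((ℓ + 1) ^ k : ℕ) : ℝ) ≤ (N : ℝ) := by exact_mod_cast hN6
  have hpv := mem_boxDom.1 p.2
  intro i
  have hb : |B6Partition236TwoLevelBox.pos x.1 i - (N : ℝ) * (q i : ℝ)| < 5 / 8 * (N : ℝ) :=
    abs_lt_of_hq_ne_zero hN1 hx i
  rw [abs_lt] at hb
  simp only [B6Partition236TwoLevelBox.pos] at hb
  obtain ⟨hb1, hb2⟩ := hb
  have hpx : |(((p.1 i : ℤ) : ℝ)) - ((x.1 i : ℤ) : ℝ)| ≤ (N : ℝ) / 3 := by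
    have h1 := (abs_le_supNorm (p.1 - x.1) i).trans hp
    rw [Pi.sub_apply, Int.cast_abs, Int.cast_sub] at h1
    linarith
  rw [abs_le] at hpx
  obtain ⟨hpx1, hpx2⟩ := hpx
  obtain ⟨hp0, hp1⟩ := hpv i
  have hqi := (mem_ctrs.1 hq) i
  have elo : (((ℓ + 1) ^ k : ℕ) : ℤ) * (cubeO ℓ Mh q i : ℤ) = (N : ℤ) * (cubeLo q i : ℤ) := by
    simp only [cubeO, hNdef]; push_cast; ring
  have ehi : (((ℓ + 1) ^ k : ℕ) : ℤ) * ((cubeO ℓ Mh q i : ℤ) + (((ℓ + 1) * cubeM' Mh P q i : ℕ) : ℤ))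
      = (N : ℤ) * ((cubeLo q i + cubeW P q i : ℕ) : ℤ) := by
    simp only [cubeO, cubeM', hNdef]; push_cast; ring
  rw [elo, ehi, cubeLo_add_cubeW_eq hP hq, cubeLo_eq hq]
  have hp1' : p.1 i < (N : ℤ) * (P i : ℤ) := by
    have : (((ℓ + 1) ^ k * ((ℓ + 1) * (Mh * P i)) : ℕ) : ℤ) = (N : ℤ) * (P i : ℤ) := by
      rw [hNdef]; push_cast; ring
    rw [← this]; exact_mod_cast hp1
  constructor
  · rcases le_or_gt (q i) 0 with hq0 | hq0
    · have : q i = 0 := le_antisymm hq0 hqi.1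
      rw [this]; simp; exact hp0
    · rw [max_eq_left (by omega)]
      have hr : ((N : ℤ) * (q i - 1) : ℝ) < ((p.1 i : ℤ) : ℝ) := by
        push_cast; nlinarith
      have : (N : ℤ) * (q i - 1) < p.1 i := by exact_mod_cast hr
      exact this.le
  · rcases le_or_gt (P i : ℤ) (q i + 1) with hqP | hqP
    · rw [min_eq_right hqP]; exact hp1'
    · rw [min_eq_left hqP.le]
      have hr : ((p.1 i : ℤ) : ℝ) < ((N : ℤ) * (q i + 1) : ℝ) := by
        push_cast; nlinarith
      exact_mod_cast hr

end Geometry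

/-! ## §3 The printed cut-off: the mixed second difference «|Δ^ηh| ≤ O(M⁻²)» -/

section CutoffDD

/-- `|Π f − Π g| ≤ Σ|f − g|` for `[0,1]`-valued factors. [folklore] -/
private theorem abs_prod_sub_prod_le {ι : Type*} (s : Finset ι) {f g : ι → ℝ} (hf : ∀ i, 0 ≤ f i ∧ f i ≤ 1)
    (hg : ∀ i, 0 ≤ g i ∧ g i ≤ 1) : |∏ i ∈ s, f i - ∏ i ∈ s, g i| ≤ ∑ i ∈ s, |f i - g i| := by
  classical
  induction s using Finset.induction_on with
  | empty => simp
  | insert a s ha ih =>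
    rw [Finset.prod_insert ha, Finset.prod_insert ha, Finset.sum_insert ha]
    have hPf : 0 ≤ ∏ i ∈ s, f i ∧ ∏ i ∈ s, f i ≤ 1 :=
      ⟨Finset.prod_nonneg fun i _ => (hf i).1, Finset.prod_le_one (fun i _ => (hf i).1) fun i _ => (hf i).2⟩
    have e : f a * ∏ i ∈ s, f i - g a * ∏ i ∈ s, g i
        = (f a - g a) * ∏ i ∈ s, f i + g a * (∏ i ∈ s, f i - ∏ i ∈ s, g i) := by ring
    rw [e]
    calc |(f a - g a) * ∏ i ∈ s, f i + g a * (∏ i ∈ s, f i - ∏ i ∈ s, g i)|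
        ≤ |(f a - g a) * ∏ i ∈ s, f i| + |g a * (∏ i ∈ s, f i - ∏ i ∈ s, g i)| := abs_add_le _ _
      _ ≤ |f a - g a| + |∏ i ∈ s, f i - ∏ i ∈ s, g i| := by
          rw [abs_mul, abs_mul, abs_of_nonneg hPf.1, abs_of_nonneg (hg a).1]
          exact add_le_add (mul_le_of_le_one_right (abs_nonneg _) hPf.2)
            (mul_le_of_le_one_left (abs_nonneg _) (hg a).2)
      _ ≤ |f a - g a| + ∑ i ∈ s, |f i - g i| := by gcongr

/-- the mixed second difference of a `C₀^∞` function: `|(f(b+η) − f(b)) − (f(a+η) − f(a))| ≤ sup|f″|·|η|·|b − a|`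
(mean value theorem twice). [folklore] -/
private theorem abs_mixed_diff_le_D2 {f : ℝ → ℝ} (hf : ContDiff ℝ ∞ f) (hs : HasCompactSupport f) (a b η : ℝ) :
    |(f (b + η) - f b) - (f (a + η) - f a)| ≤ D2 f * |η| * |b - a| := by
  have hdiff : Differentiable ℝ f := hf.differentiable (by simp)
  have hdiff' : Differentiable ℝ (deriv f) :=
    (contDiff_infty_iff_deriv.mp hf).2.differentiable (by simp)
  have hg : ∀ u, HasDerivAt (fun u => f (u + η) - f u) (deriv f (u + η) - deriv f u) u := fun u =>
    ((hdiff (u + η)).hasDerivAt.comp_add_const u η).sub (hdiff u).hasDerivAt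
  have hgb : ∀ u, |deriv (fun u => f (u + η) - f u) u| ≤ D2 f * |η| := by
    intro u
    rw [(hg u).deriv]
    have h := Convex.norm_image_sub_le_of_norm_deriv_le (f := deriv f) (s := Set.univ)
      (fun x _ => (hdiff' x)) (fun x _ => by rw [Real.norm_eq_abs]; exact abs_deriv2_le_D2 hf hs x)
      convex_univ (Set.mem_univ u) (Set.mem_univ (u + η))
    simpa only [Real.norm_eq_abs, add_sub_cancel_left] using h
  have key := Convex.norm_image_sub_le_of_norm_deriv_le (f := fun u => f (u + η) - f u) (s := Set.univ)
    (fun x _ => (hg x).differentiableAt) (fun x _ => by rw [Real.norm_eq_abs]; exact hgb x)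
    convex_univ (Set.mem_univ a) (Set.mem_univ b)
  simpa only [Real.norm_eq_abs] using key

/-- the physical position of a site shifted along `μ`, coordinate `μ`. [folklore] -/
private theorem pos_add_single_same (x : Fin (d + 1) → ℤ) (μ : Fin (d + 1)) :
    B6Partition236TwoLevelBox.pos (x + Pi.single μ 1) μ = B6Partition236TwoLevelBox.pos x μ + 1 := by
  simp only [B6Partition236TwoLevelBox.pos, Pi.add_apply, Pi.single_eq_same]
  push_cast
  ring

/-- the physical position of a site shifted along `μ`, the other coordinates. [folklore] -/
private theorem pos_add_single_ne (x : Fin (d + 1) → ℤ) {μ ν : Fin (d + 1)} (h : ν ≠ μ) :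
    B6Partition236TwoLevelBox.pos (x + Pi.single μ 1) ν = B6Partition236TwoLevelBox.pos x ν := by
  simp only [B6Partition236TwoLevelBox.pos, Pi.add_apply, Pi.single_eq_of_ne h, add_zero]

/-- **«|Δ^ηh| ≤ O(M⁻²)», MIXED FORM**: the second difference of the printed cut-off over a unit step `e_μ` and a
displacement `x′ − x` is `≤ (sup|h″| + d·sup|h′|²)·|x′ − x|_∞/N²` (`N = nM` fine sites per half-width; product rule
on `h_q = h((x_μ+½)/N − q_μ)·Π_{ν≠μ}h((x_ν+½)/N − q_ν)`, the mean value theorem twice in direction `μ`, once in the others).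
[cite: Balaban1983RegularityDecay, §2 p.577 («|∂^ηh_j| ≤ O(M⁻¹)», «|Δ^ηh_j| ≤ O(M⁻²)»); Balaban1984PropagatorsII, (2.36) p.229, (2.40) p.230] -/
theorem abs_hq_dd_le {n M : ℕ} (hN : 1 ≤ n * M) (q : Fin (d + 1) → ℤ) (μ : Fin (d + 1))
    (x x' : Fin (d + 1) → ℤ) :
    |(hq n M q (x' + Pi.single μ 1) - hq n M q x') - (hq n M q (x + Pi.single μ 1) - hq n M q x)|
      ≤ (D2 hprof + d * D1 hprof ^ 2) * supNorm (x' - x) / ((n * M : ℕ) : ℝ) ^ 2 := by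
  have hNr : (0 : ℝ) < ((n * M : ℕ) : ℝ) := by exact_mod_cast hN
  have hD1 := D1_nonneg contDiff_hprof hasCompactSupport_hprof
  have hD2 := D2_nonneg contDiff_hprof hasCompactSupport_hprof
  set Nr : ℝ := ((n * M : ℕ) : ℝ) with hNrdef
  -- the arguments of the profile
  set t : (Fin (d + 1) → ℤ) → Fin (d + 1) → ℝ := fun y ν => B6Partition236TwoLevelBox.pos y ν / Nr - q ν with ht
  have htμ : ∀ y, t (y + Pi.single μ 1) μ = t y μ + 1 / Nr := by
    intro y; simp only [ht]; rw [pos_add_single_same]; ring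
  have htν : ∀ y ν, ν ≠ μ → t (y + Pi.single μ 1) ν = t y ν := by
    intro y ν hν; simp only [ht]; rw [pos_add_single_ne _ hν]
  have htdiff : ∀ ν, |t x' ν - t x ν| ≤ supNorm (x' - x) / Nr := by
    intro ν
    have e : t x' ν - t x ν = ((((x' ν : ℤ) : ℝ)) - ((x ν : ℤ) : ℝ)) / Nr := by
      simp only [ht, B6Partition236TwoLevelBox.pos]; field_simp; ring
    rw [e, abs_div, abs_of_pos hNr]
    refine div_le_div_of_nonneg_right ?_ hNr.le
    have := abs_le_supNorm (x' - x) ν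
    rw [Pi.sub_apply] at this
    push_cast at this
    exact this
  -- the complementary factor
  set R : (Fin (d + 1) → ℤ) → ℝ := fun y => ∏ ν ∈ Finset.univ.erase μ, hprof (t y ν) with hR
  have hRshift : ∀ y, R (y + Pi.single μ 1) = R y := by
    intro y
    simp only [hR]
    exact Finset.prod_congr rfl fun ν hν => by rw [htν y ν (Finset.ne_of_mem_erase hν)]
  have hR01 : ∀ y, 0 ≤ R y ∧ R y ≤ 1 := fun y =>
    ⟨Finset.prod_nonneg fun _ _ => hprof_nonneg _, Finset.prod_le_one (fun _ _ => hprof_nonneg _) fun _ _ => hprof_le_one _⟩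
  have hRdiff : |R x' - R x| ≤ d * D1 hprof * (supNorm (x' - x) / Nr) := by
    simp only [hR]
    refine (abs_prod_sub_prod_le _ (fun ν => ⟨hprof_nonneg _, hprof_le_one _⟩)
      (fun ν => ⟨hprof_nonneg _, hprof_le_one _⟩)).trans ?_
    calc ∑ ν ∈ Finset.univ.erase μ, |hprof (t x' ν) - hprof (t x ν)|
        ≤ ∑ _ν ∈ Finset.univ.erase μ, D1 hprof * (supNorm (x' - x) / Nr) := by
          refine Finset.sum_le_sum fun ν _ => ?_
          exact (abs_sub_le_D1 contDiff_hprof hasCompactSupport_hprof _ _).trans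
            (mul_le_mul_of_nonneg_left (htdiff ν) hD1)
      _ = d * D1 hprof * (supNorm (x' - x) / Nr) := by
          rw [Finset.sum_const, Finset.card_erase_of_mem (Finset.mem_univ μ), Finset.card_univ, Fintype.card_fin,
            nsmul_eq_mul]
          push_cast
          ring
  -- the factor of direction `μ`
  set A : (Fin (d + 1) → ℤ) → ℝ := fun y => hprof (t y μ + 1 / Nr) - hprof (t y μ) with hA
  have hAx : |A x| ≤ D1 hprof / Nr := by
    simp only [hA]
    have h := abs_sub_le_D1 contDiff_hprof hasCompactSupport_hprof (t x μ) (t x μ + 1 / Nr)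
    rw [show t x μ + 1 / Nr - t x μ = 1 / Nr by ring, abs_of_pos (one_div_pos.2 hNr : (0 : ℝ) < 1 / Nr)] at h
    simpa only [mul_one_div] using h
  have hAdiff : |A x' - A x| ≤ D2 hprof * (1 / Nr) * (supNorm (x' - x) / Nr) := by
    simp only [hA]
    have h := abs_mixed_diff_le_D2 contDiff_hprof hasCompactSupport_hprof (t x μ) (t x' μ) (1 / Nr)
    rw [abs_of_pos (one_div_pos.2 hNr : (0 : ℝ) < 1 / Nr)] at h
    exact h.trans (mul_le_mul_of_nonneg_left (htdiff μ) (mul_nonneg hD2 (one_div_pos.2 hNr).le))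
  -- the product rule
  have hprod : ∀ y, hq n M q y = hprof (t y μ) * R y := fun y => hq_eq_mul_prod n M q y μ
  have hdiff1 : ∀ y, hq n M q (y + Pi.single μ 1) - hq n M q y = A y * R y := by
    intro y
    rw [hprod, hprod, hRshift, htμ]
    simp only [hA]
    ring
  have hs0 : 0 ≤ supNorm (x' - x) := supNorm_nonneg _
  rw [hdiff1, hdiff1, show A x' * R x' - A x * R x = (A x' - A x) * R x' + A x * (R x' - R x) by ring]
  calc |(A x' - A x) * R x' + A x * (R x' - R x)|
      ≤ |(A x' - A x) * R x'| + |A x * (R x' - R x)| := abs_add_le _ _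
    _ = |A x' - A x| * |R x'| + |A x| * |R x' - R x| := by rw [abs_mul, abs_mul]
    _ ≤ D2 hprof * (1 / Nr) * (supNorm (x' - x) / Nr) * 1 + D1 hprof / Nr * (d * D1 hprof * (supNorm (x' - x) / Nr)) := by
        refine add_le_add ?_ ?_
        · refine mul_le_mul hAdiff ?_ (abs_nonneg _) (by positivity)
          rw [abs_of_nonneg (hR01 x').1]; exact (hR01 x').2
        · exact mul_le_mul hAx hRdiff (abs_nonneg _) (by positivity)
    _ = (D2 hprof + d * D1 hprof ^ 2) * supNorm (x' - x) / Nr ^ 2 := by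
        field_simp

end CutoffDD

/-! ## §4 Dictionary: doubly differenced rows of a padded cube kernel at an embedded quadruple -/

section Dictionary

variable {ℓ k Mh : ℕ} {P : Fin (d + 1) → ℕ} {q : Fin (d + 1) → ℤ}
set_option maxHeartbeats 400000 in
/-- the weighted doubly differenced row of a padded cube kernel at an embedded quadruple is the doubly differenced row on
the cube, with the same two-centre weight (the embedding is an isometry). [cite: Balaban1983RegularityDecay, §2 p.575, dictionary] -/
theorem wsum2_pad_emb_quad (hP : ∀ i, 1 ≤ P i) (hq : q ∈ ctrs P) (δ : ℝ) (n : ℕ) (W t : ℝ)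
    (T : Matrix ↥(Box d ℓ k (fun i => (ℓ + 1) * cubeM' Mh P q i)) ↥(Box d ℓ k (fun i => (ℓ + 1) * cubeM' Mh P q i)) ℝ)
    (a ae a' ae' : ↥(Box d ℓ k (fun i => (ℓ + 1) * cubeM' Mh P q i))) :
    wsum2 δ n (emb ℓ k Mh P q hP hq a) (emb ℓ k Mh P q hP hq a') (fun z =>
        W * (t * ((((res (emb ℓ k Mh P q hP hq))ᵀ * T * res (emb ℓ k Mh P q hP hq)) (emb ℓ k Mh P q hP hq ae') z
          - ((res (emb ℓ k Mh P q hP hq))ᵀ * T * res (emb ℓ k Mh P q hP hq)) (emb ℓ k Mh P q hP hq a') z)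
          - (((res (emb ℓ k Mh P q hP hq))ᵀ * T * res (emb ℓ k Mh P q hP hq)) (emb ℓ k Mh P q hP hq ae) z
          - ((res (emb ℓ k Mh P q hP hq))ᵀ * T * res (emb ℓ k Mh P q hP hq)) (emb ℓ k Mh P q hP hq a) z))))
      = wsum2 δ n a a' (fun c => W * (t * ((T ae' c - T a' c) - (T ae c - T a c)))) := by
  have hinj := emb_injective (ℓ := ℓ) (k := k) (Mh := Mh) hP hq
  unfold wsum2
  have hoff : ∀ z ∈ (Finset.univ : Finset ↥(Box d ℓ k (fun i => (ℓ + 1) * (Mh * P i)))),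
      z ∉ Finset.univ.image (emb ℓ k Mh P q hP hq) →
      |W * (t * ((((res (emb ℓ k Mh P q hP hq))ᵀ * T * res (emb ℓ k Mh P q hP hq)) (emb ℓ k Mh P q hP hq ae') z
          - ((res (emb ℓ k Mh P q hP hq))ᵀ * T * res (emb ℓ k Mh P q hP hq)) (emb ℓ k Mh P q hP hq a') z)
          - (((res (emb ℓ k Mh P q hP hq))ᵀ * T * res (emb ℓ k Mh P q hP hq)) (emb ℓ k Mh P q hP hq ae) z
          - ((res (emb ℓ k Mh P q hP hq))ᵀ * T * res (emb ℓ k Mh P q hP hq)) (emb ℓ k Mh P q hP hq a) z)))|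
        * Real.exp (δ * min (supNorm ((emb ℓ k Mh P q hP hq a).1 - z.1))
            (supNorm ((emb ℓ k Mh P q hP hq a').1 - z.1)) / n) = 0 := by
    intro z _ hz
    have hne : ∀ b, emb ℓ k Mh P q hP hq b ≠ z := fun b hb =>
      hz (Finset.mem_image.2 ⟨b, Finset.mem_univ _, hb⟩)
    rw [mul_res_apply_off _ _ _ hne, mul_res_apply_off _ _ _ hne, mul_res_apply_off _ _ _ hne,
      mul_res_apply_off _ _ _ hne]
    simp
  rw [← Finset.sum_subset (Finset.subset_univ _) hoff, Finset.sum_image (fun b _ b' _ h => hinj h)]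
  refine Finset.sum_congr rfl fun c _ => ?_
  rw [Matrix.mul_assoc, transpose_res_mul_apply_img hinj, transpose_res_mul_apply_img hinj,
    transpose_res_mul_apply_img hinj, transpose_res_mul_apply_img hinj, mul_res_apply_img hinj,
    mul_res_apply_img hinj, mul_res_apply_img hinj, mul_res_apply_img hinj, emb_sub_emb hP hq, emb_sub_emb hP hq]

end Dictionary

/-! ## §5 The long difference of two rows of the cube propagator -/

section LongDiff

variable {N' : Fin (d + 1) → ℕ}

/-- **THE LONG DIFFERENCE OF TWO ROWS OF A CUBE KERNEL**: if every nearest-neighbour differenced row has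
`wsum_u(n(T(u+e_i,·) − T(u,·))) ≤ c_d`, then for `|b − a|_∞ ≤ s`,
`wsum_a(T(b,·) − T(a,·)) ≤ (d+1)|b − a|_∞·e^{δs/n}·c_d/n` — «a difference over distance `s` costs `s·L^{−j}` derivative
bounds». [cite: Balaban1984PropagatorsII, (2.43) p.230 (derivative clause), Proposition 2.2 (2.67) p.234, bookkeeping] -/
theorem wsum_longDiff_le {δ : ℝ} (hδ : 0 ≤ δ) {n : ℕ} (hn : 1 ≤ n)
    (T : Matrix ↥(boxDom N') ↥(boxDom N') ℝ) {cd : ℝ} (hcd : 0 ≤ cd)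
    (hT : ∀ (i : Fin (d + 1)) (u ue : ↥(boxDom N')), ue.1 = u.1 + Pi.single i 1 →
      wsum δ n u (fun c => (n : ℝ) * (T ue c - T u c)) ≤ cd)
    (a b : ↥(boxDom N')) {s : ℝ} (hs : supNorm (b.1 - a.1) ≤ s) :
    wsum δ n a (fun c => T b c - T a c) ≤ (d + 1) * supNorm (b.1 - a.1) * (Real.exp (δ * s / n) * cd / n) := by
  have hn' : (0 : ℝ) < n := by exact_mod_cast hn
  have hB0 : 0 ≤ Real.exp (δ * s / n) * cd / n := by positivity
  unfold wsum
  refine rowDiff_tele_le T (fun c => Real.exp (δ * supNorm (a.1 - c.1) / n)) (fun c => (Real.exp_pos _).le) a b hB0 ?_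
  intro i u ue hue hlo hhi
  -- `|a − u|_∞ ≤ s`
  have hau : supNorm (a.1 - u.1) ≤ s := by
    refine B4Reflection242.supNorm_le_of_forall fun j => ?_
    have h1 := hlo j
    have h2 : u.1 j ≤ max (a.1 j) (b.1 j) := by
      have := hhi j
      rw [hue, Pi.add_apply] at this
      by_cases hj : j = i
      · subst hj; rw [Pi.single_eq_same] at this; omega
      · rw [Pi.single_eq_of_ne hj, add_zero] at this; exact this
    have h3 := abs_le_supNorm (b.1 - a.1) j
    rw [Pi.sub_apply] at h3
    have h4 : ((|(a.1 - u.1) j| : ℤ) : ℝ) ≤ ((|b.1 j - a.1 j| : ℤ) : ℝ) := by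
      rw [Pi.sub_apply]
      have : |a.1 j - u.1 j| ≤ |b.1 j - a.1 j| := by
        rw [abs_le]
        constructor
        · rcases le_total (a.1 j) (b.1 j) with hab | hab
          · rw [max_eq_right hab] at h2; rw [abs_of_nonneg (by omega)]; omega
          · rw [max_eq_left hab] at h2; rw [abs_of_nonpos (by omega)]; omega
        · rcases le_total (a.1 j) (b.1 j) with hab | hab
          · rw [min_eq_left hab] at h1; rw [abs_of_nonneg (by omega)]; omega
          · rw [min_eq_right hab] at h1; rw [abs_of_nonpos (by omega)]; omega
      exact_mod_cast this
    exact h4.trans (h3.trans hs)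
  -- weight transfer from `a` to `u`
  have hw : ∀ c : ↥(boxDom N'), Real.exp (δ * supNorm (a.1 - c.1) / n)
      ≤ Real.exp (δ * s / n) * Real.exp (δ * supNorm (u.1 - c.1) / n) := by
    intro c
    rw [← Real.exp_add]
    apply Real.exp_le_exp.2
    rw [← add_div, ← mul_add]
    refine div_le_div_of_nonneg_right (mul_le_mul_of_nonneg_left ?_ hδ) hn'.le
    exact (supNorm_sub_le_sub_add_sub a.1 u.1 c.1).trans (by linarith)
  have hstep : wsum δ n u (fun c => T ue c - T u c) ≤ cd / n := by
    rw [le_div_iff₀ hn', mul_comm, ← wsum_mul_left δ n u hn'.le]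
    exact hT i u ue hue
  calc ∑ c, |T ue c - T u c| * Real.exp (δ * supNorm (a.1 - c.1) / n)
      ≤ ∑ c, |T ue c - T u c| * (Real.exp (δ * s / n) * Real.exp (δ * supNorm (u.1 - c.1) / n)) :=
        Finset.sum_le_sum fun c _ => mul_le_mul_of_nonneg_left (hw c) (abs_nonneg _)
    _ = Real.exp (δ * s / n) * wsum δ n u (fun c => T ue c - T u c) := by
        unfold wsum
        rw [Finset.mul_sum]
        exact Finset.sum_congr rfl fun c _ => by ring
    _ ≤ Real.exp (δ * s / n) * (cd / n) := mul_le_mul_of_nonneg_left hstep (Real.exp_pos _).le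
    _ = Real.exp (δ * s / n) * cd / n := by ring

end LongDiff

/-! ## §6 The (2.64)-input for the Hölder norm: the doubly differenced rows of `G′₀ = Σ_q h_qG′(□_q)h_q` -/

section GZeroHolder

variable {N : Fin (d + 1) → ℕ}

/-- `wsum2(c·g·h) ≤ |c|·wsum2(g)` for `|h| ≤ 1`. [folklore] -/
private theorem wsum2_cmul_le (δ : ℝ) (n : ℕ) (x x' : ↥(boxDom N)) (c : ℝ) (g h : ↥(boxDom N) → ℝ)
    (hh : ∀ z, |h z| ≤ 1) : wsum2 δ n x x' (fun z => c * (g z * h z)) ≤ |c| * wsum2 δ n x x' g := by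
  refine wsum2_le_mul_of_abs_le δ n x x' fun z => ?_
  rw [abs_mul, abs_mul]
  calc |c| * (|g z| * |h z|) ≤ |c| * (|g z| * 1) := by gcongr; exact hh z
    _ = |c| * |g z| := by ring

/-- `wsum(g·h) ≤ wsum(g)` for `|h| ≤ 1`. [folklore] -/
private theorem wsum_mulh_le (δ : ℝ) (n : ℕ) (x : ↥(boxDom N)) (g h : ↥(boxDom N) → ℝ) (hh : ∀ z, |h z| ≤ 1) :
    wsum δ n x (fun z => g z * h z) ≤ wsum δ n x g := by
  have := wsum_le_mul_of_abs_le δ n x (g := fun z => g z * h z) (g' := g) (c := 1) fun z => by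
    rw [abs_mul, one_mul]
    calc |g z| * |h z| ≤ |g z| * 1 := by gcongr; exact hh z
      _ = |g z| := mul_one _
  simpa only [one_mul] using this

/-- `wsum` depends only on the function. [folklore] -/
private theorem wsum_congr' (δ : ℝ) (n : ℕ) (x : ↥(boxDom N)) {g g' : ↥(boxDom N) → ℝ} (h : ∀ z, g z = g' z) :
    wsum δ n x g = wsum δ n x g' := by
  unfold wsum
  exact Finset.sum_congr rfl fun z _ => by rw [h z]

/-- `wsum2` of the zero vector vanishes. [folklore] -/
private theorem wsum2_zero (δ : ℝ) (n : ℕ) (x x' : ↥(boxDom N)) : wsum2 δ n x x' (fun _ => 0) = 0 := by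
  unfold wsum2; simp

/-- THE COEFFICIENT OF THE FIRST TERM: `(n/s)^α·n·|dd h_q| ≤ sup|h″| + d·sup|h′|²` when `(n/s)^α·s ≤ n`
(`|dd h_q| ≤ (…)s/N²`, `N = nM ≥ n`). [cite: Balaban1983RegularityDecay, §2 p.577 («|Δ^ηh_j| ≤ O(M⁻²)»)] -/
private theorem coef_dd_le {n M : ℕ} (hn : 1 ≤ n) (hM : 1 ≤ M) (q : Fin (d + 1) → ℤ) (μ : Fin (d + 1))
    (x xe x' xe' : Fin (d + 1) → ℤ) (hxe : xe = x + Pi.single μ 1) (hxe' : xe' = x' + Pi.single μ 1)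
    {W : ℝ} (hW0 : 0 ≤ W) (hWs : W * supNorm (x' - x) ≤ n) :
    |W * ((n : ℝ) * ((hq n M q xe' - hq n M q x') - (hq n M q xe - hq n M q x)))|
      ≤ D2 hprof + d * D1 hprof ^ 2 := by
  subst hxe hxe'
  have hN : 1 ≤ n * M := Nat.one_le_iff_ne_zero.2 (Nat.mul_ne_zero_iff.2 ⟨by omega, by omega⟩)
  have hn' : (0 : ℝ) < n := by exact_mod_cast hn
  have hM' : (1 : ℝ) ≤ M := by exact_mod_cast hM
  have hM0 : (0 : ℝ) < M := by linarith
  have hD1 := D1_nonneg contDiff_hprof hasCompactSupport_hprof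
  have hD2 := D2_nonneg contDiff_hprof hasCompactSupport_hprof
  have hK : 0 ≤ D2 hprof + d * D1 hprof ^ 2 := by positivity
  have hdd := abs_hq_dd_le hN q μ x x'
  have hNM : ((n * M : ℕ) : ℝ) = (n : ℝ) * M := by push_cast; ring
  rw [hNM] at hdd
  rw [abs_mul, abs_mul, abs_of_nonneg hW0, abs_of_nonneg hn'.le]
  calc W * ((n : ℝ) * |(hq n M q (x' + Pi.single μ 1) - hq n M q x') - (hq n M q (x + Pi.single μ 1) - hq n M q x)|)
      ≤ W * ((n : ℝ) * ((D2 hprof + d * D1 hprof ^ 2) * supNorm (x' - x) / ((n : ℝ) * M) ^ 2)) := by gcongr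
    _ = (D2 hprof + d * D1 hprof ^ 2) * (W * supNorm (x' - x)) / ((n : ℝ) * M ^ 2) := by
        field_simp
    _ ≤ (D2 hprof + d * D1 hprof ^ 2) * n / ((n : ℝ) * M ^ 2) := by gcongr
    _ = (D2 hprof + d * D1 hprof ^ 2) / M ^ 2 := by field_simp
    _ ≤ D2 hprof + d * D1 hprof ^ 2 := div_le_self hK (one_le_pow₀ hM')

/-- THE COEFFICIENT OF THE SECOND TERM: `(n/s)^α·|h_q(x′) − h_q(x)| ≤ (d+1)·sup|h′|` when `(n/s)^α·s ≤ n`.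
[cite: Balaban1983RegularityDecay, §2 p.577 («|∂^ηh_j| ≤ O(M⁻¹)»)] -/
private theorem coef_lip_le {n M : ℕ} (hn : 1 ≤ n) (hM : 1 ≤ M) (q x x' : Fin (d + 1) → ℤ) {W : ℝ} (hW0 : 0 ≤ W)
    (hWs : W * supNorm (x' - x) ≤ n) : |W * (hq n M q x' - hq n M q x)| ≤ (d + 1) * D1 hprof := by
  have hn' : (0 : ℝ) < n := by exact_mod_cast hn
  have hM' : (1 : ℝ) ≤ M := by exact_mod_cast hM
  have hM0 : (0 : ℝ) < M := by linarith
  have hD1 := D1_nonneg contDiff_hprof hasCompactSupport_hprof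
  have h := abs_hq_sub_le (d := d) hn hM q x x'
  rw [abs_mul, abs_of_nonneg hW0]
  calc W * |hq n M q x' - hq n M q x| ≤ W * ((d + 1) * D1 hprof / M * supNorm (x' - x) / n) := by gcongr
    _ = (d + 1) * D1 hprof / M * (W * supNorm (x' - x)) / n := by ring
    _ ≤ (d + 1) * D1 hprof / M * n / n := by gcongr
    _ = (d + 1) * D1 hprof / M := by field_simp
    _ ≤ (d + 1) * D1 hprof := div_le_self (by positivity) hM'

/-- THE COEFFICIENT OF THE THIRD TERM: `n|h_q(x + e_μ) − h_q(x)| ≤ (d+1)·sup|h′|`.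
[cite: Balaban1983RegularityDecay, §2 p.577 («|∂^ηh_j| ≤ O(M⁻¹)»)] -/
private theorem coef_nb_le {n M : ℕ} (hn : 1 ≤ n) (hM : 1 ≤ M) (q x xe : Fin (d + 1) → ℤ)
    (hxe : supNorm (xe - x) ≤ 1) : |(n : ℝ) * (hq n M q xe - hq n M q x)| ≤ (d + 1) * D1 hprof := by
  have hn' : (0 : ℝ) < n := by exact_mod_cast hn
  have hM' : (1 : ℝ) ≤ M := by exact_mod_cast hM
  have hM0 : (0 : ℝ) < M := by linarith
  have hD1 := D1_nonneg contDiff_hprof hasCompactSupport_hprof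
  have h := abs_hq_sub_le (d := d) hn hM q x xe
  rw [abs_mul, abs_of_nonneg hn'.le]
  calc (n : ℝ) * |hq n M q xe - hq n M q x| ≤ (n : ℝ) * ((d + 1) * D1 hprof / M * supNorm (xe - x) / n) := by gcongr
    _ = (d + 1) * D1 hprof / M * supNorm (xe - x) := by field_simp
    _ ≤ (d + 1) * D1 hprof / M * 1 := by gcongr
    _ = (d + 1) * D1 hprof / M := mul_one _
    _ ≤ (d + 1) * D1 hprof := div_le_self (by positivity) hM'

variable {ℓ k Mh : ℕ} {P : Fin (d + 1) → ℕ} {q : Fin (d + 1) → ℤ}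

/-- a nearest-neighbour pair within two unit lengths of a site carrying `h_q` lies in `□_q`, as a nearest-neighbour pair
of the cube. [cite: Balaban1983RegularityDecay, §2 p.575, (2.6) p.576] -/
theorem exists_emb_pair_near (hℓ : 1 ≤ ℓ) (hk : 1 ≤ k) (hMh : 3 ≤ Mh) (hP : ∀ i, 1 ≤ P i) (hq : q ∈ ctrs P)
    {μ : Fin (d + 1)} {x y ye : ↥(Box d ℓ k (fun i => (ℓ + 1) * (Mh * P i)))} (hx : hΩ ℓ k Mh P q x ≠ 0)
    (hy : supNorm (y.1 - x.1) ≤ 2 * (((ℓ + 1) ^ k : ℕ) : ℝ))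
    (hye : supNorm (ye.1 - x.1) ≤ 2 * (((ℓ + 1) ^ k : ℕ) : ℝ)) (he : ye.1 = y.1 + Pi.single μ 1) :
    ∃ b be : ↥(Box d ℓ k (fun i => (ℓ + 1) * cubeM' Mh P q i)),
      emb ℓ k Mh P q hP hq b = y ∧ emb ℓ k Mh P q hP hq be = ye ∧ be.1 = b.1 + Pi.single μ 1 := by
  obtain ⟨b, hb⟩ := exists_emb_eq_of_near hℓ hk hMh hP hq hx hy
  obtain ⟨be, hbe⟩ := exists_emb_eq_of_near hℓ hk hMh hP hq hx hye
  refine ⟨b, be, hb, hbe, ?_⟩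
  have h := emb_sub_emb hP hq be b
  rw [hb, hbe, he, add_sub_cancel_left] at h
  rw [h, add_sub_cancel]

/-- **THE NEAR PAIRS** `|x′ − x|_∞ < n` of the (2.64)-input for the Hölder entry, deterministic form: given the three
cube-level inputs at a common rate `δ` — rows of `G′(□_q)` `≤ c′`, differenced rows `≤ c_d`, Hölder-weighted doubly
differenced rows `≤ c_H` — the Hölder-weighted doubly differenced row of `G′₀ = Σ_q h_qG′(□_q)h_q` over the quadruple
`x, x+e_μ, x′, x′+e_μ` has two-centre functional `≤ 4·2^{d+1}·(B₁ + B₂ + B₃ + B₄)` (the four terms of the product rule,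
at most `4·2^{d+1}` cubes). [cite: Balaban1984PropagatorsII, (2.64) p.234, (2.43) p.230; Balaban1983RegularityDecay, §2 pp.575–577] -/
theorem wsum2_gZero_holder_near {ℓ k Mh : ℕ} {P : Fin (d + 1) → ℕ} (hℓ : 1 ≤ ℓ) (hk : 1 ≤ k) (hMh : 3 ≤ Mh)
    (hP : ∀ i, 1 ≤ P i) {aj a m2 : ℝ} (Λ : Finset ↥(boxDom (fun i => (ℓ + 1) * (Mh * P i))))
    {δ c' cd cH α : ℝ} (hδ : 0 < δ) (hc' : 0 ≤ c') (hcd : 0 ≤ cd) (hcH : 0 ≤ cH) (hα1 : α ≤ 1) {μ : Fin (d + 1)}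
    (h243 : ∀ (q : ↥(ctrs P)) (b : ↥(Box d ℓ k (fun i => (ℓ + 1) * cubeM' Mh P q.1 i))),
      roww δ ((ℓ + 1) ^ k) (cubeG ℓ k Mh P aj a m2 Λ hP q) b ≤ c')
    (h243d : ∀ (q : ↥(ctrs P)) (i : Fin (d + 1)) (u ue : ↥(Box d ℓ k (fun i => (ℓ + 1) * cubeM' Mh P q.1 i))),
      ue.1 = u.1 + Pi.single i 1 →
      wsum δ ((ℓ + 1) ^ k) u (fun c => (((ℓ + 1) ^ k : ℕ) : ℝ)
        * (cubeG ℓ k Mh P aj a m2 Λ hP q ue c - cubeG ℓ k Mh P aj a m2 Λ hP q u c)) ≤ cd)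
    (hH : ∀ (q : ↥(ctrs P)) (u ue u' ue' : ↥(Box d ℓ k (fun i => (ℓ + 1) * cubeM' Mh P q.1 i))),
      ue.1 = u.1 + Pi.single μ 1 → ue'.1 = u'.1 + Pi.single μ 1 → u'.1 ≠ u.1 →
      wsum2 δ ((ℓ + 1) ^ k) u u' (fun c => ((((ℓ + 1) ^ k : ℕ) : ℝ) / supNorm (u'.1 - u.1)) ^ α
        * ((((ℓ + 1) ^ k : ℕ) : ℝ) * ((cubeG ℓ k Mh P aj a m2 Λ hP q ue' c - cubeG ℓ k Mh P aj a m2 Λ hP q u' c)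
          - (cubeG ℓ k Mh P aj a m2 Λ hP q ue c - cubeG ℓ k Mh P aj a m2 Λ hP q u c)))) ≤ cH)
    {x xe x' xe' : ↥(Box d ℓ k (fun i => (ℓ + 1) * (Mh * P i)))} (hxe : xe.1 = x.1 + Pi.single μ 1)
    (hxe' : xe'.1 = x'.1 + Pi.single μ 1) (hne : x'.1 ≠ x.1)
    (hsn : supNorm (x'.1 - x.1) < (((ℓ + 1) ^ k : ℕ) : ℝ)) :
    wsum2 δ ((ℓ + 1) ^ k) x x' (fun z => ((((ℓ + 1) ^ k : ℕ) : ℝ) / supNorm (x'.1 - x.1)) ^ α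
        * ((((ℓ + 1) ^ k : ℕ) : ℝ)
          * ((B6Eq250.gZero (hDiag ℓ k Mh P) (gPad ℓ k Mh P aj a m2 Λ hP) xe' z
              - B6Eq250.gZero (hDiag ℓ k Mh P) (gPad ℓ k Mh P aj a m2 Λ hP) x' z)
            - (B6Eq250.gZero (hDiag ℓ k Mh P) (gPad ℓ k Mh P aj a m2 Λ hP) xe z
              - B6Eq250.gZero (hDiag ℓ k Mh P) (gPad ℓ k Mh P aj a m2 Λ hP) x z))))
      ≤ 4 * 2 ^ (d + 1) * ((D2 hprof + d * D1 hprof ^ 2) * (Real.exp δ * c') + (d + 1) * D1 hprof * cd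
          + (d + 1) * D1 hprof * (Real.exp δ * ((d + 1) * (Real.exp δ * cd))) + cH) := by
  have hD1 := D1_nonneg contDiff_hprof hasCompactSupport_hprof
  have hD2 := D2_nonneg contDiff_hprof hasCompactSupport_hprof
  have hMh1 : 1 ≤ Mh := le_trans (by norm_num) hMh
  have hn1 : 1 ≤ (ℓ + 1) ^ k := Nat.one_le_pow _ _ (by omega)
  have hnr : (0 : ℝ) < (((ℓ + 1) ^ k : ℕ) : ℝ) := by exact_mod_cast hn1
  have hnr1 : (1 : ℝ) ≤ (((ℓ + 1) ^ k : ℕ) : ℝ) := by exact_mod_cast hn1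
  have hM1 : 1 ≤ (ℓ + 1) * Mh := Nat.one_le_iff_ne_zero.2 (by positivity)
  have hN1 : 1 ≤ (ℓ + 1) ^ k * ((ℓ + 1) * Mh) := Nat.one_le_iff_ne_zero.2 (by positivity)
  -- the constants of the four terms
  obtain ⟨B₁, hB₁⟩ : ∃ B : ℝ, B = (D2 hprof + d * D1 hprof ^ 2) * (Real.exp δ * c') := ⟨_, rfl⟩
  obtain ⟨B₂, hB₂⟩ : ∃ B : ℝ, B = (d + 1) * D1 hprof * cd := ⟨_, rfl⟩
  obtain ⟨B₃, hB₃⟩ : ∃ B : ℝ, B = (d + 1) * D1 hprof * (Real.exp δ * ((d + 1) * (Real.exp δ * cd))) := ⟨_, rfl⟩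
  have hB₁0 : 0 ≤ B₁ := by rw [hB₁]; positivity
  have hB₂0 : 0 ≤ B₂ := by rw [hB₂]; positivity
  have hB₃0 : 0 ≤ B₃ := by rw [hB₃]; positivity
  obtain ⟨B, hB⟩ : ∃ B' : ℝ, B' = B₁ + B₂ + B₃ + cH := ⟨_, rfl⟩
  have hB0 : 0 ≤ B := by rw [hB]; positivity
  -- the distance `s = |x′ − x|_∞ ∈ [1, n[` and the Hölder weight
  obtain ⟨s, hs⟩ : ∃ s : ℝ, s = supNorm (x'.1 - x.1) := ⟨_, rfl⟩
  have hs1 : 1 ≤ s := by rw [hs]; exact B4StripSumsHolder.one_le_supNorm (sub_ne_zero.2 hne)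
  have hs0 : 0 < s := lt_of_lt_of_le one_pos hs1
  have hsn' : s < (((ℓ + 1) ^ k : ℕ) : ℝ) := by rw [hs]; exact hsn
  obtain ⟨Wt, hWt⟩ : ∃ W : ℝ, W = ((((ℓ + 1) ^ k : ℕ) : ℝ) / s) ^ α := ⟨_, rfl⟩
  have hWt0 : 0 ≤ Wt := by rw [hWt]; exact Real.rpow_nonneg (div_nonneg hnr.le hs0.le) α
  have hWs : Wt * s ≤ (((ℓ + 1) ^ k : ℕ) : ℝ) := by
    have h1 : 1 ≤ (((ℓ + 1) ^ k : ℕ) : ℝ) / s := by rw [le_div_iff₀ hs0, one_mul]; exact hsn'.le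
    rw [hWt]
    calc ((((ℓ + 1) ^ k : ℕ) : ℝ) / s) ^ α * s ≤ (((ℓ + 1) ^ k : ℕ) : ℝ) / s * s :=
          mul_le_mul_of_nonneg_right (rpow_le_self_of_one_le h1 hα1) hs0.le
      _ = (((ℓ + 1) ^ k : ℕ) : ℝ) := div_mul_cancel₀ _ hs0.ne'
  have hWs' : Wt * supNorm (x'.1 - x.1) ≤ (((ℓ + 1) ^ k : ℕ) : ℝ) := by rw [← hs]; exact hWs
  have hWrw : ((((ℓ + 1) ^ k : ℕ) : ℝ) / supNorm (x'.1 - x.1)) ^ α = Wt := by rw [hWt, hs]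
  rw [hWrw]
  obtain ⟨G₀, hG₀⟩ : ∃ G, G = B6Eq250.gZero (hDiag ℓ k Mh P) (gPad ℓ k Mh P aj a m2 Λ hP) := ⟨_, rfl⟩
  rw [← hG₀]
  -- neighbour distances and distances to the support point (all `≤ 2n`)
  have hdxe : supNorm (x.1 - xe.1) ≤ 1 := by
    rw [hxe, show x.1 - (x.1 + Pi.single μ 1) = -(Pi.single μ (1 : ℤ) : Fin (d + 1) → ℤ) by abel,
      B4TorusKernel.supNorm_neg]
    exact supNorm_single_le μ
  have hdxe' : supNorm (x'.1 - xe'.1) ≤ 1 := by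
    rw [hxe', show x'.1 - (x'.1 + Pi.single μ 1) = -(Pi.single μ (1 : ℤ) : Fin (d + 1) → ℤ) by abel,
      B4TorusKernel.supNorm_neg]
    exact supNorm_single_le μ
  have hdxex : supNorm (xe.1 - x.1) ≤ 1 := by
    rw [hxe, add_sub_cancel_left]; exact supNorm_single_le μ
  have h2n : (1 : ℝ) ≤ 2 * (((ℓ + 1) ^ k : ℕ) : ℝ) := by linarith
  have hdx'x : supNorm (x'.1 - x.1) ≤ 2 * (((ℓ + 1) ^ k : ℕ) : ℝ) := by rw [← hs]; linarith
  have hdxe'x : supNorm (xe'.1 - x.1) ≤ 2 * (((ℓ + 1) ^ k : ℕ) : ℝ) := by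
    have h3 := supNorm_sub_le_sub_add_sub xe'.1 x'.1 x.1
    have h' : supNorm (xe'.1 - x'.1) ≤ 1 := by rw [hxe', add_sub_cancel_left]; exact supNorm_single_le μ
    rw [← hs] at h3; linarith
  have hdxex2 : supNorm (xe.1 - x.1) ≤ 2 * (((ℓ + 1) ^ k : ℕ) : ℝ) := hdxex.trans h2n
  have hdxexe : supNorm (xe.1 - xe.1) ≤ 2 * (((ℓ + 1) ^ k : ℕ) : ℝ) :=
    B4Reflection242.supNorm_le_of_forall fun i => by
      rw [sub_self, Pi.zero_apply, abs_zero, Int.cast_zero]; positivity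
  have hexe : xe'.1 - xe.1 = x'.1 - x.1 := by rw [hxe, hxe']; abel
  have hdxe'xe : supNorm (xe'.1 - xe.1) ≤ 2 * (((ℓ + 1) ^ k : ℕ) : ℝ) := by rw [hexe]; exact hdx'x
  -- the per-cube terms
  obtain ⟨T, hT⟩ : ∃ T : ↥(ctrs P) → ↥(Box d ℓ k (fun i => (ℓ + 1) * (Mh * P i))) → ℝ, T = fun q z =>
      Wt * ((((ℓ + 1) ^ k : ℕ) : ℝ) * ((hΩ ℓ k Mh P q.1 xe' * gPad ℓ k Mh P aj a m2 Λ hP q xe' z * hΩ ℓ k Mh P q.1 z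
        - hΩ ℓ k Mh P q.1 x' * gPad ℓ k Mh P aj a m2 Λ hP q x' z * hΩ ℓ k Mh P q.1 z)
        - (hΩ ℓ k Mh P q.1 xe * gPad ℓ k Mh P aj a m2 Λ hP q xe z * hΩ ℓ k Mh P q.1 z
        - hΩ ℓ k Mh P q.1 x * gPad ℓ k Mh P aj a m2 Λ hP q x z * hΩ ℓ k Mh P q.1 z))) := ⟨_, rfl⟩
  have hsplit : ∀ z, Wt * ((((ℓ + 1) ^ k : ℕ) : ℝ) * ((G₀ xe' z - G₀ x' z) - (G₀ xe z - G₀ x z)))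
      = ∑ q : ↥(ctrs P), T q z := by
    intro z
    rw [hG₀, B6Eq250.gZero_eq_sum_aTerm, Matrix.sum_apply, Matrix.sum_apply, Matrix.sum_apply, Matrix.sum_apply,
      ← Finset.sum_sub_distrib, ← Finset.sum_sub_distrib, ← Finset.sum_sub_distrib, Finset.mul_sum, Finset.mul_sum]
    refine Finset.sum_congr rfl fun q _ => ?_
    rw [B6Eq250.aTerm_apply, hT]
    unfold hDiag
    simp only [Matrix.mul_diagonal, Matrix.diagonal_mul]
  -- the four pieces of the product rule
  obtain ⟨U₁, hU₁⟩ : ∃ U : ↥(ctrs P) → ↥(Box d ℓ k (fun i => (ℓ + 1) * (Mh * P i))) → ℝ, U = fun q z =>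
      (Wt * ((((ℓ + 1) ^ k : ℕ) : ℝ) * ((hΩ ℓ k Mh P q.1 xe' - hΩ ℓ k Mh P q.1 x')
        - (hΩ ℓ k Mh P q.1 xe - hΩ ℓ k Mh P q.1 x))))
        * (gPad ℓ k Mh P aj a m2 Λ hP q xe' z * hΩ ℓ k Mh P q.1 z) := ⟨_, rfl⟩
  obtain ⟨U₂, hU₂⟩ : ∃ U : ↥(ctrs P) → ↥(Box d ℓ k (fun i => (ℓ + 1) * (Mh * P i))) → ℝ, U = fun q z =>
      (Wt * (hΩ ℓ k Mh P q.1 x' - hΩ ℓ k Mh P q.1 x))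
        * ((((ℓ + 1) ^ k : ℕ) : ℝ) * (gPad ℓ k Mh P aj a m2 Λ hP q xe' z - gPad ℓ k Mh P aj a m2 Λ hP q x' z)
          * hΩ ℓ k Mh P q.1 z) := ⟨_, rfl⟩
  obtain ⟨U₃, hU₃⟩ : ∃ U : ↥(ctrs P) → ↥(Box d ℓ k (fun i => (ℓ + 1) * (Mh * P i))) → ℝ, U = fun q z =>
      ((((ℓ + 1) ^ k : ℕ) : ℝ) * (hΩ ℓ k Mh P q.1 xe - hΩ ℓ k Mh P q.1 x))
        * (Wt * (gPad ℓ k Mh P aj a m2 Λ hP q xe' z - gPad ℓ k Mh P aj a m2 Λ hP q xe z) * hΩ ℓ k Mh P q.1 z) :=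
    ⟨_, rfl⟩
  obtain ⟨U₄, hU₄⟩ : ∃ U : ↥(ctrs P) → ↥(Box d ℓ k (fun i => (ℓ + 1) * (Mh * P i))) → ℝ, U = fun q z =>
      hΩ ℓ k Mh P q.1 x * (Wt * ((((ℓ + 1) ^ k : ℕ) : ℝ)
        * ((gPad ℓ k Mh P aj a m2 Λ hP q xe' z - gPad ℓ k Mh P aj a m2 Λ hP q x' z)
          - (gPad ℓ k Mh P aj a m2 Λ hP q xe z - gPad ℓ k Mh P aj a m2 Λ hP q x z))) * hΩ ℓ k Mh P q.1 z) :=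
    ⟨_, rfl⟩
  have hU : ∀ q z, T q z = U₁ q z + U₂ q z + U₃ q z + U₄ q z := by
    intro q z
    rw [hT, hU₁, hU₂, hU₃, hU₄]
    ring
  -- rows of the padded cube propagator
  have hrowPad : ∀ (q : ↥(ctrs P)) (y : ↥(Box d ℓ k (fun i => (ℓ + 1) * (Mh * P i)))),
      roww δ ((ℓ + 1) ^ k) (gPad ℓ k Mh P aj a m2 Λ hP q) y ≤ c' := by
    intro q y
    unfold gPad
    by_cases hy : ∃ b, emb ℓ k Mh P q.1 hP q.2 b = y
    · obtain ⟨b, hb⟩ := hy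
      rw [← hb, roww_pad_emb hP q.2]
      exact h243 q b
    · push Not at hy
      rw [roww_pad_off hP q.2 _ _ _ hy]
      exact hc'
  -- FIRST TERM
  have hT1 : ∀ q : ↥(ctrs P), wsum2 δ ((ℓ + 1) ^ k) x x' (U₁ q) ≤ B₁ := by
    intro q
    have hc1 : |Wt * ((((ℓ + 1) ^ k : ℕ) : ℝ) * ((hΩ ℓ k Mh P q.1 xe' - hΩ ℓ k Mh P q.1 x')
        - (hΩ ℓ k Mh P q.1 xe - hΩ ℓ k Mh P q.1 x)))| ≤ D2 hprof + d * D1 hprof ^ 2 :=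
      coef_dd_le hn1 hM1 q.1 μ x.1 xe.1 x'.1 xe'.1 hxe hxe' hWt0 hWs'
    have hrw : wsum δ ((ℓ + 1) ^ k) xe' (fun z => gPad ℓ k Mh P aj a m2 Λ hP q xe' z)
        = roww δ ((ℓ + 1) ^ k) (gPad ℓ k Mh P aj a m2 Λ hP q) xe' := rfl
    rw [hU₁]
    calc wsum2 δ ((ℓ + 1) ^ k) x x' (fun z => (Wt * ((((ℓ + 1) ^ k : ℕ) : ℝ)
          * ((hΩ ℓ k Mh P q.1 xe' - hΩ ℓ k Mh P q.1 x') - (hΩ ℓ k Mh P q.1 xe - hΩ ℓ k Mh P q.1 x))))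
          * (gPad ℓ k Mh P aj a m2 Λ hP q xe' z * hΩ ℓ k Mh P q.1 z))
        ≤ |Wt * ((((ℓ + 1) ^ k : ℕ) : ℝ) * ((hΩ ℓ k Mh P q.1 xe' - hΩ ℓ k Mh P q.1 x')
          - (hΩ ℓ k Mh P q.1 xe - hΩ ℓ k Mh P q.1 x)))|
            * wsum2 δ ((ℓ + 1) ^ k) x x' (fun z => gPad ℓ k Mh P aj a m2 Λ hP q xe' z) :=
          wsum2_cmul_le _ _ _ _ _ _ _ fun z => abs_hq_le_one _ _ _ _
      _ ≤ (D2 hprof + d * D1 hprof ^ 2) * (Real.exp δ * c') := by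
          refine mul_le_mul hc1 ?_ (wsum2_nonneg _ _ _ _ _) (by positivity)
          calc wsum2 δ ((ℓ + 1) ^ k) x x' (fun z => gPad ℓ k Mh P aj a m2 Λ hP q xe' z)
              ≤ wsum δ ((ℓ + 1) ^ k) x' (fun z => gPad ℓ k Mh P aj a m2 Λ hP q xe' z) :=
                wsum2_le_wsum_right hδ.le _ _ _ _
            _ ≤ Real.exp (δ * 1 / ((ℓ + 1) ^ k : ℕ)) * wsum δ ((ℓ + 1) ^ k) xe'
                  (fun z => gPad ℓ k Mh P aj a m2 Λ hP q xe' z) := wsum_shift_le hδ.le _ x' xe' hdxe' _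
            _ ≤ Real.exp δ * c' := by
                rw [hrw]
                exact mul_le_mul (exp_rate_le hδ.le hn1 hnr1) (hrowPad q xe') (roww_nonneg _ _ _ _)
                  (Real.exp_pos _).le
      _ = B₁ := by rw [hB₁]
  -- SECOND TERM
  have hT2 : ∀ q : ↥(ctrs P), wsum2 δ ((ℓ + 1) ^ k) x x' (U₂ q) ≤ B₂ := by
    intro q
    have hc2 : |Wt * (hΩ ℓ k Mh P q.1 x' - hΩ ℓ k Mh P q.1 x)| ≤ (d + 1) * D1 hprof :=
      coef_lip_le hn1 hM1 q.1 x.1 x'.1 hWt0 hWs'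
    by_cases h2z : hΩ ℓ k Mh P q.1 x' - hΩ ℓ k Mh P q.1 x = 0
    · have hz : ∀ z, U₂ q z = 0 := fun z => by simp only [hU₂, h2z, mul_zero, zero_mul]
      rw [wsum2_congr δ _ x x' hz, wsum2_zero]
      exact hB₂0
    · -- both `x′` and `x′ + e_μ` lie in `□_q`
      obtain ⟨a', ae', hxa', hxae', hae'⟩ : ∃ a' ae' : ↥(Box d ℓ k (fun i => (ℓ + 1) * cubeM' Mh P q.1 i)),
          emb ℓ k Mh P q.1 hP q.2 a' = x' ∧ emb ℓ k Mh P q.1 hP q.2 ae' = xe' ∧ ae'.1 = a'.1 + Pi.single μ 1 := by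
        by_cases hx'0 : hΩ ℓ k Mh P q.1 x' ≠ 0
        · exact exists_emb_pair_of_hΩ_ne_zero hℓ hk hMh1 hP q.2 hxe' hx'0
        · push Not at hx'0
          have hx0 : hΩ ℓ k Mh P q.1 x ≠ 0 := by
            intro h0; apply h2z; rw [hx'0, h0, sub_zero]
          exact exists_emb_pair_near hℓ hk hMh hP q.2 hx0 hdx'x hdxe'x hxe'
      have hder : wsum δ ((ℓ + 1) ^ k) x' (fun z => (((ℓ + 1) ^ k : ℕ) : ℝ)
          * (gPad ℓ k Mh P aj a m2 Λ hP q xe' z - gPad ℓ k Mh P aj a m2 Λ hP q x' z)) ≤ cd := by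
        rw [← hxa', ← hxae']
        unfold gPad
        rw [wsum_pad_emb_pair hP q.2]
        exact h243d q μ a' ae' hae'
      rw [hU₂]
      calc wsum2 δ ((ℓ + 1) ^ k) x x' (fun z => (Wt * (hΩ ℓ k Mh P q.1 x' - hΩ ℓ k Mh P q.1 x))
            * ((((ℓ + 1) ^ k : ℕ) : ℝ) * (gPad ℓ k Mh P aj a m2 Λ hP q xe' z - gPad ℓ k Mh P aj a m2 Λ hP q x' z)
              * hΩ ℓ k Mh P q.1 z))
          ≤ |Wt * (hΩ ℓ k Mh P q.1 x' - hΩ ℓ k Mh P q.1 x)| * wsum2 δ ((ℓ + 1) ^ k) x x'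
              (fun z => (((ℓ + 1) ^ k : ℕ) : ℝ)
                * (gPad ℓ k Mh P aj a m2 Λ hP q xe' z - gPad ℓ k Mh P aj a m2 Λ hP q x' z)) :=
            wsum2_cmul_le _ _ _ _ _ _ _ fun z => abs_hq_le_one _ _ _ _
        _ ≤ (d + 1) * D1 hprof * cd := by
            refine mul_le_mul hc2 ((wsum2_le_wsum_right hδ.le _ _ _ _).trans hder) (wsum2_nonneg _ _ _ _ _)
              (by positivity)
        _ = B₂ := by rw [hB₂]
  -- THIRD TERM
  have hT3 : ∀ q : ↥(ctrs P), wsum2 δ ((ℓ + 1) ^ k) x x' (U₃ q) ≤ B₃ := by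
    intro q
    have hc3 : |(((ℓ + 1) ^ k : ℕ) : ℝ) * (hΩ ℓ k Mh P q.1 xe - hΩ ℓ k Mh P q.1 x)| ≤ (d + 1) * D1 hprof :=
      coef_nb_le hn1 hM1 q.1 x.1 xe.1 hdxex
    by_cases h3z : hΩ ℓ k Mh P q.1 xe - hΩ ℓ k Mh P q.1 x = 0
    · have hz : ∀ z, U₃ q z = 0 := fun z => by simp only [hU₃, h3z, mul_zero, zero_mul]
      rw [wsum2_congr δ _ x x' hz, wsum2_zero]
      exact hB₃0
    · -- `x + e_μ` and `x′ + e_μ` lie in `□_q`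
      obtain ⟨ae, ae', hxae, hxae'⟩ : ∃ ae ae' : ↥(Box d ℓ k (fun i => (ℓ + 1) * cubeM' Mh P q.1 i)),
          emb ℓ k Mh P q.1 hP q.2 ae = xe ∧ emb ℓ k Mh P q.1 hP q.2 ae' = xe' := by
        by_cases hx0 : hΩ ℓ k Mh P q.1 x ≠ 0
        · obtain ⟨ae, hae⟩ := exists_emb_eq_of_near hℓ hk hMh hP q.2 hx0 hdxex2
          obtain ⟨ae', hae'⟩ := exists_emb_eq_of_near hℓ hk hMh hP q.2 hx0 hdxe'x
          exact ⟨ae, ae', hae, hae'⟩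
        · push Not at hx0
          have hxe0 : hΩ ℓ k Mh P q.1 xe ≠ 0 := by
            intro h0; apply h3z; rw [hx0, h0, sub_zero]
          obtain ⟨ae, hae⟩ := exists_emb_eq_of_near hℓ hk hMh hP q.2 hxe0 hdxexe
          obtain ⟨ae', hae'⟩ := exists_emb_eq_of_near hℓ hk hMh hP q.2 hxe0 hdxe'xe
          exact ⟨ae, ae', hae, hae'⟩
      have hsae : supNorm (ae'.1 - ae.1) = s := by
        rw [hs, ← hexe, ← hxae, ← hxae', emb_sub_emb hP q.2]
      have hlong : wsum δ ((ℓ + 1) ^ k) xe (fun z => gPad ℓ k Mh P aj a m2 Λ hP q xe' z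
          - gPad ℓ k Mh P aj a m2 Λ hP q xe z)
          ≤ (d + 1) * s * (Real.exp (δ * (((ℓ + 1) ^ k : ℕ) : ℝ) / ((ℓ + 1) ^ k : ℕ)) * cd / ((ℓ + 1) ^ k : ℕ)) := by
        rw [← hxae, ← hxae']
        unfold gPad
        rw [wsum_congr' δ ((ℓ + 1) ^ k) _ (fun z => (one_mul _).symm), wsum_pad_emb_pair hP q.2,
          wsum_congr' δ ((ℓ + 1) ^ k) _ (fun b => one_mul _), ← hsae]
        exact wsum_longDiff_le hδ.le hn1 _ hcd (fun i u ue hue => h243d q i u ue hue) ae ae'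
          (by rw [hsae]; exact hsn'.le)
      have hE : Real.exp (δ * (((ℓ + 1) ^ k : ℕ) : ℝ) / ((ℓ + 1) ^ k : ℕ)) = Real.exp δ := by
        rw [mul_div_assoc, div_self hnr.ne', mul_one]
      rw [hE] at hlong
      rw [hU₃]
      calc wsum2 δ ((ℓ + 1) ^ k) x x' (fun z => ((((ℓ + 1) ^ k : ℕ) : ℝ)
            * (hΩ ℓ k Mh P q.1 xe - hΩ ℓ k Mh P q.1 x))
            * (Wt * (gPad ℓ k Mh P aj a m2 Λ hP q xe' z - gPad ℓ k Mh P aj a m2 Λ hP q xe z) * hΩ ℓ k Mh P q.1 z))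
          ≤ |(((ℓ + 1) ^ k : ℕ) : ℝ) * (hΩ ℓ k Mh P q.1 xe - hΩ ℓ k Mh P q.1 x)| * wsum2 δ ((ℓ + 1) ^ k) x x'
              (fun z => Wt * (gPad ℓ k Mh P aj a m2 Λ hP q xe' z - gPad ℓ k Mh P aj a m2 Λ hP q xe z)) :=
            wsum2_cmul_le _ _ _ _ _ _ _ fun z => abs_hq_le_one _ _ _ _
        _ ≤ (d + 1) * D1 hprof * (Wt * (Real.exp δ * ((d + 1) * s * (Real.exp δ * cd / ((ℓ + 1) ^ k : ℕ))))) := by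
            refine mul_le_mul hc3 ?_ (wsum2_nonneg _ _ _ _ _) (by positivity)
            calc wsum2 δ ((ℓ + 1) ^ k) x x'
                  (fun z => Wt * (gPad ℓ k Mh P aj a m2 Λ hP q xe' z - gPad ℓ k Mh P aj a m2 Λ hP q xe z))
                ≤ wsum δ ((ℓ + 1) ^ k) x
                    (fun z => Wt * (gPad ℓ k Mh P aj a m2 Λ hP q xe' z - gPad ℓ k Mh P aj a m2 Λ hP q xe z)) :=
                  wsum2_le_wsum_left hδ.le _ _ _ _
              _ = Wt * wsum δ ((ℓ + 1) ^ k) x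
                    (fun z => gPad ℓ k Mh P aj a m2 Λ hP q xe' z - gPad ℓ k Mh P aj a m2 Λ hP q xe z) :=
                  wsum_mul_left _ _ _ hWt0 _
              _ ≤ Wt * (Real.exp (δ * 1 / ((ℓ + 1) ^ k : ℕ)) * wsum δ ((ℓ + 1) ^ k) xe
                    (fun z => gPad ℓ k Mh P aj a m2 Λ hP q xe' z - gPad ℓ k Mh P aj a m2 Λ hP q xe z)) :=
                  mul_le_mul_of_nonneg_left (wsum_shift_le hδ.le _ x xe hdxe _) hWt0
              _ ≤ Wt * (Real.exp δ * ((d + 1) * s * (Real.exp δ * cd / ((ℓ + 1) ^ k : ℕ)))) := by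
                  exact mul_le_mul_of_nonneg_left (mul_le_mul (exp_rate_le hδ.le hn1 hnr1) hlong
                    (wsum_nonneg _ _ _ _) (Real.exp_pos _).le) hWt0
        _ = (d + 1) * D1 hprof * (Real.exp δ * ((d + 1) * (Real.exp δ * cd)))
              * (Wt * s / (((ℓ + 1) ^ k : ℕ) : ℝ)) := by ring
        _ ≤ (d + 1) * D1 hprof * (Real.exp δ * ((d + 1) * (Real.exp δ * cd))) * 1 := by
            refine mul_le_mul_of_nonneg_left ?_ (by positivity)
            rwa [div_le_one hnr]
        _ = B₃ := by rw [hB₃, mul_one]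
  -- FOURTH TERM
  have hT4 : ∀ q : ↥(ctrs P), wsum2 δ ((ℓ + 1) ^ k) x x' (U₄ q) ≤ cH := by
    intro q
    by_cases hx0 : hΩ ℓ k Mh P q.1 x = 0
    · have hz : ∀ z, U₄ q z = 0 := fun z => by simp only [hU₄, hx0, zero_mul]
      rw [wsum2_congr δ _ x x' hz, wsum2_zero]
      exact hcH
    · obtain ⟨a₀, ae, hxa, hxae, hae⟩ := exists_emb_pair_of_hΩ_ne_zero hℓ hk hMh1 hP q.2 hxe hx0
      obtain ⟨a', ae', hxa', hxae', hae'⟩ := exists_emb_pair_near hℓ hk hMh hP q.2 hx0 hdx'x hdxe'x hxe'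
      have hne' : a'.1 ≠ a₀.1 := by
        intro h
        apply hne
        rw [← hxa, ← hxa', Subtype.ext h]
      have hsw : s = supNorm (a'.1 - a₀.1) := by
        rw [hs, ← hxa, ← hxa', emb_sub_emb hP q.2]
      have hdd : wsum2 δ ((ℓ + 1) ^ k) x x' (fun z => Wt * ((((ℓ + 1) ^ k : ℕ) : ℝ)
          * ((gPad ℓ k Mh P aj a m2 Λ hP q xe' z - gPad ℓ k Mh P aj a m2 Λ hP q x' z)
            - (gPad ℓ k Mh P aj a m2 Λ hP q xe z - gPad ℓ k Mh P aj a m2 Λ hP q x z)))) ≤ cH := by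
        rw [hWt, hsw, ← hxa, ← hxae, ← hxa', ← hxae']
        unfold gPad
        rw [wsum2_pad_emb_quad hP q.2]
        exact hH q a₀ ae a' ae' hae hae' hne'
      rw [hU₄]
      calc wsum2 δ ((ℓ + 1) ^ k) x x' (fun z => hΩ ℓ k Mh P q.1 x * (Wt * ((((ℓ + 1) ^ k : ℕ) : ℝ)
            * ((gPad ℓ k Mh P aj a m2 Λ hP q xe' z - gPad ℓ k Mh P aj a m2 Λ hP q x' z)
              - (gPad ℓ k Mh P aj a m2 Λ hP q xe z - gPad ℓ k Mh P aj a m2 Λ hP q x z))) * hΩ ℓ k Mh P q.1 z))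
          ≤ |hΩ ℓ k Mh P q.1 x| * wsum2 δ ((ℓ + 1) ^ k) x x' (fun z => Wt * ((((ℓ + 1) ^ k : ℕ) : ℝ)
            * ((gPad ℓ k Mh P aj a m2 Λ hP q xe' z - gPad ℓ k Mh P aj a m2 Λ hP q x' z)
              - (gPad ℓ k Mh P aj a m2 Λ hP q xe z - gPad ℓ k Mh P aj a m2 Λ hP q x z)))) :=
            wsum2_cmul_le _ _ _ _ _ _ _ fun z => abs_hq_le_one _ _ _ _
        _ ≤ 1 * cH := mul_le_mul (abs_hq_le_one _ _ _ _) hdd (wsum2_nonneg _ _ _ _ _) zero_le_one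
        _ = cH := one_mul _
  -- the per-cube bound
  have hcube : ∀ q : ↥(ctrs P), wsum2 δ ((ℓ + 1) ^ k) x x' (T q) ≤ B := by
    intro q
    rw [wsum2_congr δ _ x x' (fun z => hU q z)]
    have e4 : wsum2 δ ((ℓ + 1) ^ k) x x' (fun z => U₁ q z + U₂ q z + U₃ q z + U₄ q z)
        ≤ wsum2 δ ((ℓ + 1) ^ k) x x' (fun z => U₁ q z + U₂ q z + U₃ q z) + wsum2 δ ((ℓ + 1) ^ k) x x' (U₄ q) :=
      wsum2_add_le δ _ x x' (fun z => U₁ q z + U₂ q z + U₃ q z) (U₄ q)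
    have e3 : wsum2 δ ((ℓ + 1) ^ k) x x' (fun z => U₁ q z + U₂ q z + U₃ q z)
        ≤ wsum2 δ ((ℓ + 1) ^ k) x x' (fun z => U₁ q z + U₂ q z) + wsum2 δ ((ℓ + 1) ^ k) x x' (U₃ q) :=
      wsum2_add_le δ _ x x' (fun z => U₁ q z + U₂ q z) (U₃ q)
    have e2 : wsum2 δ ((ℓ + 1) ^ k) x x' (fun z => U₁ q z + U₂ q z)
        ≤ wsum2 δ ((ℓ + 1) ^ k) x x' (U₁ q) + wsum2 δ ((ℓ + 1) ^ k) x x' (U₂ q) :=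
      wsum2_add_le δ _ x x' (U₁ q) (U₂ q)
    have b1 := hT1 q
    have b2 := hT2 q
    have b3 := hT3 q
    have b4 := hT4 q
    rw [hB]
    linarith
  -- the overlap count: `T_q ≡ 0` unless the cut-off of `q` sees one of the four points
  have hT0 : ∀ q : ↥(ctrs P), wsum2 δ ((ℓ + 1) ^ k) x x' (T q) ≠ 0 →
      q.1 ∈ (near ((ℓ + 1) ^ k * ((ℓ + 1) * Mh)) x.1 ∪ near ((ℓ + 1) ^ k * ((ℓ + 1) * Mh)) xe.1)
        ∪ (near ((ℓ + 1) ^ k * ((ℓ + 1) * Mh)) x'.1 ∪ near ((ℓ + 1) ^ k * ((ℓ + 1) * Mh)) xe'.1) := by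
    intro q hq0
    have hNpos : (0 : ℝ) < (((ℓ + 1) ^ k * ((ℓ + 1) * Mh) : ℕ) : ℝ) := by exact_mod_cast hN1
    have h58 : 5 / 8 * (((ℓ + 1) ^ k * ((ℓ + 1) * Mh) : ℕ) : ℝ) < (((ℓ + 1) ^ k * ((ℓ + 1) * Mh) : ℕ) : ℝ) := by
      linarith
    have hmem : ∀ y : ↥(Box d ℓ k (fun i => (ℓ + 1) * (Mh * P i))), hΩ ℓ k Mh P q.1 y ≠ 0 →
        q.1 ∈ near ((ℓ + 1) ^ k * ((ℓ + 1) * Mh)) y.1 := fun y h0 =>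
      mem_near_of_abs_lt hN1 fun ν => (abs_lt_of_hq_ne_zero hN1 h0 ν).trans h58
    by_contra hnot
    simp only [Finset.mem_union, not_or] at hnot
    obtain ⟨⟨h1, h2⟩, h3, h4⟩ := hnot
    have z1 : hΩ ℓ k Mh P q.1 x = 0 := by by_contra h; exact h1 (hmem x h)
    have z2 : hΩ ℓ k Mh P q.1 xe = 0 := by by_contra h; exact h2 (hmem xe h)
    have z3 : hΩ ℓ k Mh P q.1 x' = 0 := by by_contra h; exact h3 (hmem x' h)
    have z4 : hΩ ℓ k Mh P q.1 xe' = 0 := by by_contra h; exact h4 (hmem xe' h)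
    apply hq0
    have hz : ∀ z, T q z = 0 := fun z => by simp only [hT, z1, z2, z3, z4, mul_zero, zero_mul, sub_self]
    rw [wsum2_congr δ _ x x' hz, wsum2_zero]
  have hcN : ((near ((ℓ + 1) ^ k * ((ℓ + 1) * Mh)) x.1 ∪ near ((ℓ + 1) ^ k * ((ℓ + 1) * Mh)) xe.1)
      ∪ (near ((ℓ + 1) ^ k * ((ℓ + 1) * Mh)) x'.1 ∪ near ((ℓ + 1) ^ k * ((ℓ + 1) * Mh)) xe'.1)).card
      ≤ 4 * 2 ^ (d + 1) := by
    have c1 := card_near_le ((ℓ + 1) ^ k * ((ℓ + 1) * Mh)) x.1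
    have c2 := card_near_le ((ℓ + 1) ^ k * ((ℓ + 1) * Mh)) xe.1
    have c3 := card_near_le ((ℓ + 1) ^ k * ((ℓ + 1) * Mh)) x'.1
    have c4 := card_near_le ((ℓ + 1) ^ k * ((ℓ + 1) * Mh)) xe'.1
    have u1 := Finset.card_union_le (near ((ℓ + 1) ^ k * ((ℓ + 1) * Mh)) x.1)
      (near ((ℓ + 1) ^ k * ((ℓ + 1) * Mh)) xe.1)
    have u2 := Finset.card_union_le (near ((ℓ + 1) ^ k * ((ℓ + 1) * Mh)) x'.1)
      (near ((ℓ + 1) ^ k * ((ℓ + 1) * Mh)) xe'.1)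
    have u3 := Finset.card_union_le
      (near ((ℓ + 1) ^ k * ((ℓ + 1) * Mh)) x.1 ∪ near ((ℓ + 1) ^ k * ((ℓ + 1) * Mh)) xe.1)
      (near ((ℓ + 1) ^ k * ((ℓ + 1) * Mh)) x'.1 ∪ near ((ℓ + 1) ^ k * ((ℓ + 1) * Mh)) xe'.1)
    have h := u3.trans (Nat.add_le_add (u1.trans (Nat.add_le_add c1 c2)) (u2.trans (Nat.add_le_add c3 c4)))
    have e : 2 ^ (d + 1) + 2 ^ (d + 1) + (2 ^ (d + 1) + 2 ^ (d + 1)) = 4 * 2 ^ (d + 1) := by ring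
    rw [e] at h
    exact h
  have hcardU : (((near ((ℓ + 1) ^ k * ((ℓ + 1) * Mh)) x.1 ∪ near ((ℓ + 1) ^ k * ((ℓ + 1) * Mh)) xe.1)
      ∪ (near ((ℓ + 1) ^ k * ((ℓ + 1) * Mh)) x'.1 ∪ near ((ℓ + 1) ^ k * ((ℓ + 1) * Mh)) xe'.1)).card : ℝ)
      ≤ 4 * 2 ^ (d + 1) := by exact_mod_cast hcN
  have key : ∑ q : ↥(ctrs P), wsum2 δ ((ℓ + 1) ^ k) x x' (T q)
      ≤ (((near ((ℓ + 1) ^ k * ((ℓ + 1) * Mh)) x.1 ∪ near ((ℓ + 1) ^ k * ((ℓ + 1) * Mh)) xe.1)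
        ∪ (near ((ℓ + 1) ^ k * ((ℓ + 1) * Mh)) x'.1 ∪ near ((ℓ + 1) ^ k * ((ℓ + 1) * Mh)) xe'.1)).card : ℝ) * B :=
    sum_le_card_mul₄ (fun q : ↥(ctrs P) => wsum2 δ ((ℓ + 1) ^ k) x x' (T q)) (fun q => q.1)
      Subtype.val_injective _ hT0 hB0 hcube
  -- assembly
  have hL : wsum2 δ ((ℓ + 1) ^ k) x x' (fun z => Wt * ((((ℓ + 1) ^ k : ℕ) : ℝ)
      * ((G₀ xe' z - G₀ x' z) - (G₀ xe z - G₀ x z))))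
      = wsum2 δ ((ℓ + 1) ^ k) x x' (fun z => ∑ q : ↥(ctrs P), T q z) := wsum2_congr δ ((ℓ + 1) ^ k) x x' hsplit
  have hS : wsum2 δ ((ℓ + 1) ^ k) x x' (fun z => ∑ q : ↥(ctrs P), T q z)
      ≤ ∑ q : ↥(ctrs P), wsum2 δ ((ℓ + 1) ^ k) x x' (T q) := wsum2_sum_le Finset.univ δ _ x x' T
  have hfin : (((near ((ℓ + 1) ^ k * ((ℓ + 1) * Mh)) x.1 ∪ near ((ℓ + 1) ^ k * ((ℓ + 1) * Mh)) xe.1)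
        ∪ (near ((ℓ + 1) ^ k * ((ℓ + 1) * Mh)) x'.1 ∪ near ((ℓ + 1) ^ k * ((ℓ + 1) * Mh)) xe'.1)).card : ℝ) * B
      ≤ 4 * 2 ^ (d + 1) * B := mul_le_mul_of_nonneg_right hcardU hB0
  rw [hL, ← hB₁, ← hB₂, ← hB₃, ← hB]
  exact hS.trans (key.trans hfin)

/-- **THE DOUBLY DIFFERENCED ROWS OF `G′₀`** — the (2.64)-input for the Hölder entry («(L^jη)² replaced by (L^jη)^{1−α}»):
for `0 ≤ α < 1` there are `δ₃, C₀ > 0` (functions of `d`, `ℓ`, `α`, the windows) such that for EVERY mesh `k ≥ 1`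
(`n = L^k`), `M_h ≥ 3`, volume `P`, `Λ`, window point, axis `μ` and all `x ≠ x′` of `Ω` with `x + e_μ, x′ + e_μ ∈ Ω`:
`Σ_z (n/|x′−x|_∞)^α|n(((G′₀(x′+e_μ,z) − G′₀(x′,z)) − (G′₀(x+e_μ,z) − G′₀(x,z)))|e^{δ₃min(|x−z|,|x′−z|)/n} ≤ C₀`,
`G′₀ = Σ_q h_qG′(□_q)h_q`.  FAR PAIRS `|x′−x|_∞ ≥ n`: the Hölder weight is `≤ 1` and the bound is twice the differenced
bound `wsum_gZero_deriv_le`.  NEAR PAIRS `|x′−x|_∞ < n`: the product rule for the double difference of `h_q(·)G′(□_q)(·,z)`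
has four terms — `(dd h_q)·G′(□_q)` (`|dd h_q| = O(s/N²)`, `abs_hq_dd_le`), `(h_q(x′) − h_q(x))·∂G′(□_q)` (`O(s/N)` times
(2.43)₂), `∂h_q·(G′(□_q)(x′+e_μ,·) − G′(□_q)(x+e_μ,·))` (`O(1/N)` times a long difference `= O(s)` derivative bounds,
`wsum_longDiff_le`) and `h_q·dd G′(□_q)` (the cube Hölder clause `B6Ineq243HolderTwoLevelBox.ineq243_twoLevel_holder_wsum2`)
— all four points lying in `□_q` by the margin `exists_emb_eq_of_near`; at most `4·2^{d+1}` cubes meet the four points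
(`wsum2_gZero_holder_near`).
[cite: Balaban1984PropagatorsII, (2.64) p.234 with «The similar inequalities hold … for a Hölder norm of a derivative»,
(2.43) p.230; Balaban1983RegularityDecay, Theorem (1.9) p.573] -/
theorem wsum2_gZero_holder_le (d ℓ : ℕ) (hℓ : 1 ≤ ℓ) (aminus aplus m2plus a2minus a2plus : ℝ) (ha : 0 < aminus)
    (ha2 : 0 < a2minus) (α : ℝ) (hα0 : 0 ≤ α) (hα1 : α < 1) :
    ∃ δ₃ C₀ : ℝ, 0 < δ₃ ∧ 0 < C₀ ∧ ∀ (k : ℕ), 1 ≤ k → ∀ (aj m2 a : ℝ), aminus ≤ aj → aj ≤ aplus → 0 ≤ m2 →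
      m2 ≤ m2plus → a2minus ≤ a → a ≤ a2plus → ∀ (Mh : ℕ), 3 ≤ Mh → ∀ (P : Fin (d + 1) → ℕ) (hP : ∀ i, 1 ≤ P i)
        (Λ : Finset ↥(boxDom (fun i => (ℓ + 1) * (Mh * P i)))) (μ : Fin (d + 1))
        (x xe x' xe' : ↥(Box d ℓ k (fun i => (ℓ + 1) * (Mh * P i)))),
        xe.1 = x.1 + Pi.single μ 1 → xe'.1 = x'.1 + Pi.single μ 1 → x'.1 ≠ x.1 →
          wsum2 δ₃ ((ℓ + 1) ^ k) x x' (fun z => ((((ℓ + 1) ^ k : ℕ) : ℝ) / supNorm (x'.1 - x.1)) ^ α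
              * ((((ℓ + 1) ^ k : ℕ) : ℝ)
                * ((B6Eq250.gZero (hDiag ℓ k Mh P) (gPad ℓ k Mh P aj a m2 Λ hP) xe' z
                    - B6Eq250.gZero (hDiag ℓ k Mh P) (gPad ℓ k Mh P aj a m2 Λ hP) x' z)
                  - (B6Eq250.gZero (hDiag ℓ k Mh P) (gPad ℓ k Mh P aj a m2 Λ hP) xe z
                    - B6Eq250.gZero (hDiag ℓ k Mh P) (gPad ℓ k Mh P aj a m2 Λ hP) x z)))) ≤ C₀ := by
  obtain ⟨δa, c', hδa, hc', h243⟩ := ineq243_twoLevel_roww d ℓ hℓ aminus aplus m2plus a2minus a2plus ha ha2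
  obtain ⟨δb, cd, hδb, hcd, h243d⟩ := ineq243_twoLevel_deriv_wsum d ℓ hℓ aminus aplus m2plus a2minus a2plus ha ha2
  obtain ⟨δH, cH, hδH, hcH, hH⟩ :=
    ineq243_twoLevel_holder_wsum2 d ℓ hℓ aminus aplus m2plus a2minus a2plus ha ha2 α hα0 hα1
  obtain ⟨δ₂, C₂, hδ₂, hC₂, hG0⟩ := wsum_gZero_deriv_le d ℓ hℓ aminus aplus m2plus a2minus a2plus ha ha2
  have hD1 := D1_nonneg contDiff_hprof hasCompactSupport_hprof
  have hD2 := D2_nonneg contDiff_hprof hasCompactSupport_hprof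
  obtain ⟨δ₃, hδ₃⟩ : ∃ δ : ℝ, δ = min (min δa δb) (min δH δ₂) := ⟨_, rfl⟩
  have hδ₃0 : 0 < δ₃ := by rw [hδ₃]; exact lt_min (lt_min hδa hδb) (lt_min hδH hδ₂)
  have hδ₃a : δ₃ ≤ δa := by rw [hδ₃]; exact (min_le_left _ _).trans (min_le_left _ _)
  have hδ₃b : δ₃ ≤ δb := by rw [hδ₃]; exact (min_le_left _ _).trans (min_le_right _ _)
  have hδ₃H : δ₃ ≤ δH := by rw [hδ₃]; exact (min_le_right _ _).trans (min_le_left _ _)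
  have hδ₃2 : δ₃ ≤ δ₂ := by rw [hδ₃]; exact (min_le_right _ _).trans (min_le_right _ _)
  obtain ⟨B, hB⟩ : ∃ B : ℝ, B = (D2 hprof + d * D1 hprof ^ 2) * (Real.exp δ₃ * c') + (d + 1) * D1 hprof * cd
      + (d + 1) * D1 hprof * (Real.exp δ₃ * ((d + 1) * (Real.exp δ₃ * cd))) + cH := ⟨_, rfl⟩
  have hB0 : 0 ≤ B := by rw [hB]; positivity
  refine ⟨δ₃, 4 * 2 ^ (d + 1) * B + 2 * C₂, hδ₃0, by positivity, ?_⟩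
  intro k hk aj m2 a e1 e2 e3 e4 e5 e6 Mh hMh P hP Λ μ x xe x' xe' hxe hxe' hne
  have hMh1 : 1 ≤ Mh := le_trans (by norm_num) hMh
  have hn1 : 1 ≤ (ℓ + 1) ^ k := Nat.one_le_pow _ _ (by omega)
  have hnr : (0 : ℝ) < (((ℓ + 1) ^ k : ℕ) : ℝ) := by exact_mod_cast hn1
  have hM' : ∀ q : ↥(ctrs P), ∀ i, 1 ≤ cubeM' Mh P q.1 i := fun q i =>
    Nat.one_le_iff_ne_zero.2 (Nat.mul_ne_zero_iff.2 ⟨by omega, by have := (one_le_cubeW hP q.2 i).1; omega⟩)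
  have hs0 : 0 < supNorm (x'.1 - x.1) :=
    lt_of_lt_of_le one_pos (B4StripSumsHolder.one_le_supNorm (sub_ne_zero.2 hne))
  have hWt0 : 0 ≤ ((((ℓ + 1) ^ k : ℕ) : ℝ) / supNorm (x'.1 - x.1)) ^ α :=
    Real.rpow_nonneg (div_nonneg hnr.le hs0.le) α
  have hpos : 0 ≤ 4 * 2 ^ (d + 1) * B := by positivity
  by_cases hfar : (((ℓ + 1) ^ k : ℕ) : ℝ) ≤ supNorm (x'.1 - x.1)
  · -- FAR PAIRS: the Hölder weight is `≤ 1`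
    have hWt1 : ((((ℓ + 1) ^ k : ℕ) : ℝ) / supNorm (x'.1 - x.1)) ^ α ≤ 1 :=
      Real.rpow_le_one (div_nonneg hnr.le hs0.le) ((div_le_one hs0).2 hfar) hα0
    have hsplit : ∀ z, (((ℓ + 1) ^ k : ℕ) : ℝ)
        * ((B6Eq250.gZero (hDiag ℓ k Mh P) (gPad ℓ k Mh P aj a m2 Λ hP) xe' z
            - B6Eq250.gZero (hDiag ℓ k Mh P) (gPad ℓ k Mh P aj a m2 Λ hP) x' z)
          - (B6Eq250.gZero (hDiag ℓ k Mh P) (gPad ℓ k Mh P aj a m2 Λ hP) xe z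
            - B6Eq250.gZero (hDiag ℓ k Mh P) (gPad ℓ k Mh P aj a m2 Λ hP) x z))
        = -((((ℓ + 1) ^ k : ℕ) : ℝ) * (B6Eq250.gZero (hDiag ℓ k Mh P) (gPad ℓ k Mh P aj a m2 Λ hP) xe z
            - B6Eq250.gZero (hDiag ℓ k Mh P) (gPad ℓ k Mh P aj a m2 Λ hP) x z))
          + (((ℓ + 1) ^ k : ℕ) : ℝ) * (B6Eq250.gZero (hDiag ℓ k Mh P) (gPad ℓ k Mh P aj a m2 Λ hP) xe' z
            - B6Eq250.gZero (hDiag ℓ k Mh P) (gPad ℓ k Mh P aj a m2 Λ hP) x' z) := by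
      intro z; ring
    have h1 : wsum δ₃ ((ℓ + 1) ^ k) x (fun z => -((((ℓ + 1) ^ k : ℕ) : ℝ)
        * (B6Eq250.gZero (hDiag ℓ k Mh P) (gPad ℓ k Mh P aj a m2 Λ hP) xe z
          - B6Eq250.gZero (hDiag ℓ k Mh P) (gPad ℓ k Mh P aj a m2 Λ hP) x z))) ≤ C₂ := by
      have e := wsum_le_mul_of_abs_le δ₃ ((ℓ + 1) ^ k) x
        (g := fun z => -((((ℓ + 1) ^ k : ℕ) : ℝ)
          * (B6Eq250.gZero (hDiag ℓ k Mh P) (gPad ℓ k Mh P aj a m2 Λ hP) xe z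
            - B6Eq250.gZero (hDiag ℓ k Mh P) (gPad ℓ k Mh P aj a m2 Λ hP) x z)))
        (g' := fun z => (((ℓ + 1) ^ k : ℕ) : ℝ)
          * (B6Eq250.gZero (hDiag ℓ k Mh P) (gPad ℓ k Mh P aj a m2 Λ hP) xe z
            - B6Eq250.gZero (hDiag ℓ k Mh P) (gPad ℓ k Mh P aj a m2 Λ hP) x z)) (c := 1)
        (fun z => by rw [abs_neg, one_mul])
      rw [one_mul] at e
      exact e.trans ((wsum_mono hδ₃2 _ _ _).trans (hG0 k hk aj m2 a e1 e2 e3 e4 e5 e6 Mh hMh1 P hP Λ μ x xe hxe))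
    have h2 : wsum δ₃ ((ℓ + 1) ^ k) x' (fun z => (((ℓ + 1) ^ k : ℕ) : ℝ)
        * (B6Eq250.gZero (hDiag ℓ k Mh P) (gPad ℓ k Mh P aj a m2 Λ hP) xe' z
          - B6Eq250.gZero (hDiag ℓ k Mh P) (gPad ℓ k Mh P aj a m2 Λ hP) x' z)) ≤ C₂ :=
      (wsum_mono hδ₃2 _ _ _).trans (hG0 k hk aj m2 a e1 e2 e3 e4 e5 e6 Mh hMh1 P hP Λ μ x' xe' hxe')
    have h3 := wsum2_split_le hδ₃0.le ((ℓ + 1) ^ k) x x' _ _ _ hsplit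
    rw [wsum2_mul_left _ _ _ _ hWt0]
    have h4 : wsum2 δ₃ ((ℓ + 1) ^ k) x x' (fun z => (((ℓ + 1) ^ k : ℕ) : ℝ)
        * ((B6Eq250.gZero (hDiag ℓ k Mh P) (gPad ℓ k Mh P aj a m2 Λ hP) xe' z
            - B6Eq250.gZero (hDiag ℓ k Mh P) (gPad ℓ k Mh P aj a m2 Λ hP) x' z)
          - (B6Eq250.gZero (hDiag ℓ k Mh P) (gPad ℓ k Mh P aj a m2 Λ hP) xe z
            - B6Eq250.gZero (hDiag ℓ k Mh P) (gPad ℓ k Mh P aj a m2 Λ hP) x z))) ≤ 2 * C₂ := by linarith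
    calc ((((ℓ + 1) ^ k : ℕ) : ℝ) / supNorm (x'.1 - x.1)) ^ α * wsum2 δ₃ ((ℓ + 1) ^ k) x x'
          (fun z => (((ℓ + 1) ^ k : ℕ) : ℝ)
            * ((B6Eq250.gZero (hDiag ℓ k Mh P) (gPad ℓ k Mh P aj a m2 Λ hP) xe' z
                - B6Eq250.gZero (hDiag ℓ k Mh P) (gPad ℓ k Mh P aj a m2 Λ hP) x' z)
              - (B6Eq250.gZero (hDiag ℓ k Mh P) (gPad ℓ k Mh P aj a m2 Λ hP) xe z
                - B6Eq250.gZero (hDiag ℓ k Mh P) (gPad ℓ k Mh P aj a m2 Λ hP) x z)))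
        ≤ 1 * (2 * C₂) := mul_le_mul hWt1 h4 (wsum2_nonneg _ _ _ _ _) zero_le_one
      _ ≤ 4 * 2 ^ (d + 1) * B + 2 * C₂ := by linarith
  · -- NEAR PAIRS
    have hsn : supNorm (x'.1 - x.1) < (((ℓ + 1) ^ k : ℕ) : ℝ) := lt_of_not_ge hfar
    have h243' : ∀ (q : ↥(ctrs P)) (b : ↥(Box d ℓ k (fun i => (ℓ + 1) * cubeM' Mh P q.1 i))),
        roww δ₃ ((ℓ + 1) ^ k) (cubeG ℓ k Mh P aj a m2 Λ hP q) b ≤ c' := fun q b =>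
      (roww_mono hδ₃a _ _ _).trans
        (h243 k hk aj m2 a e1 e2 e3 e4 e5 e6 (cubeM' Mh P q.1) (hM' q) (lamLoc ℓ Mh P q.1 hP q.2 Λ) b)
    have h243d' : ∀ (q : ↥(ctrs P)) (i : Fin (d + 1)) (u ue : ↥(Box d ℓ k (fun i => (ℓ + 1) * cubeM' Mh P q.1 i))),
        ue.1 = u.1 + Pi.single i 1 →
        wsum δ₃ ((ℓ + 1) ^ k) u (fun c => (((ℓ + 1) ^ k : ℕ) : ℝ)
          * (cubeG ℓ k Mh P aj a m2 Λ hP q ue c - cubeG ℓ k Mh P aj a m2 Λ hP q u c)) ≤ cd := by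
      intro q i u ue hue
      refine (wsum_mono hδ₃b _ _ _).trans ?_
      unfold wsum cubeG
      exact h243d k hk aj m2 a e1 e2 e3 e4 e5 e6 (cubeM' Mh P q.1) (hM' q) (lamLoc ℓ Mh P q.1 hP q.2 Λ) i u ue hue
    have hH' : ∀ (q : ↥(ctrs P)) (u ue u' ue' : ↥(Box d ℓ k (fun i => (ℓ + 1) * cubeM' Mh P q.1 i))),
        ue.1 = u.1 + Pi.single μ 1 → ue'.1 = u'.1 + Pi.single μ 1 → u'.1 ≠ u.1 →
        wsum2 δ₃ ((ℓ + 1) ^ k) u u' (fun c => ((((ℓ + 1) ^ k : ℕ) : ℝ) / supNorm (u'.1 - u.1)) ^ α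
          * ((((ℓ + 1) ^ k : ℕ) : ℝ) * ((cubeG ℓ k Mh P aj a m2 Λ hP q ue' c - cubeG ℓ k Mh P aj a m2 Λ hP q u' c)
            - (cubeG ℓ k Mh P aj a m2 Λ hP q ue c - cubeG ℓ k Mh P aj a m2 Λ hP q u c)))) ≤ cH := by
      intro q u ue u' ue' hue hue' hne'
      refine (wsum2_mono_rate hδ₃H _ _ _ _).trans ?_
      unfold wsum2 cubeG
      exact hH k hk aj m2 a e1 e2 e3 e4 e5 e6 (cubeM' Mh P q.1) (hM' q) (lamLoc ℓ Mh P q.1 hP q.2 Λ) μ u ue u' ue'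
        hue hue' hne'
    have hnear := wsum2_gZero_holder_near hℓ hk hMh hP Λ hδ₃0 hc'.le hcd.le hcH.le hα1.le h243' h243d' hH'
      hxe hxe' hne hsn
    rw [← hB] at hnear
    linarith

end GZeroHolder

/-! ## §7 (2.67)₄ along the printed route: `G′ = G′₀ + G′R`, `sup roww(R) ≤ ½`, the two-centre functional -/

section Prop22Holder

/-- **[B6] PROPOSITION 2.2, FOURTH ENTRY OF (2.67) (THE HÖLDER NORM OF THE DERIVATIVE, «(L^jη)² replaced by
(L^jη)^{1−α}»), FOR THE GENUINE TWO-LEVEL OPERATOR ON A BOX, ALONG THE PRINTED ROUTE** — two-centre weighted form of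
[3] (1.9): for every `0 ≤ α < 1` there are `δ, M₀, C > 0` (functions of `d`, `ℓ`, `α` and the windows) such that for
EVERY mesh `k ≥ 1` (`n = L^k`, `ξ = 1/n`), `M_h ≥ 3` with `L·M_h ≥ M₀` («M sufficiently large»), volume `P`, block union
`Λ`, window point, axis `μ` and all `x ≠ x′` of `Ω` with `x + e_μ, x′ + e_μ ∈ Ω`:
`Σ_z (n/|x′−x|_∞)^α·|n(((G′(x′+e_μ,z) − G′(x′,z)) − (G′(x+e_μ,z) − G′(x,z)))|·e^{δmin(|x−z|_∞,|x′−z|_∞)/n} ≤ C`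
for `G′ = (Δ_Ω^{L^{−j},N} + m² + Q′*aQ′)^{−1}` (`(ξ|x′−x|)^{−α}|(∂^ξ_μG′(·,z))(x′) − (∂^ξ_μG′(·,z))(x)|` summed against the
two-centre weight) — by the doubly differenced fixed-point form of (2.38)/(2.50) `ddG′ = ddG′₀ + (ddG′)R`, the
(2.64)-input `wsum2_gZero_holder_le`, the (2.51)/(2.65)-input `B6Prop22TwoLevelBox.roww_rOp_le` (`sup roww(R) ≤ C_R/M ≤ ½`)
and `wsum2(v·R) ≤ wsum2(v)·sup roww(R)` (`B6Ineq243HolderTwoLevelBox.wsum2_vecMul_le`).  HONEST SCOPE: `k = 1` geometry of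
the parametrix (two levels), `A = 0`, Neumann box `Ω`, one cube size; the cut-off `ζ` and the factor `(‖ζ‖_α + |ζ|)` of the
print are dispensed with exactly as in [3] (1.9) for parallelepipeds («the inequalities hold without any restrictions on
the points x, x′»); constants existential.
[cite: Balaban1984PropagatorsII, Proposition 2.2 (2.64)–(2.67) p.234; Balaban1983RegularityDecay, Theorem (1.9) p.573] -/
theorem prop22_entry4_twoLevelBox (d ℓ : ℕ) (hℓ : 1 ≤ ℓ) (aminus aplus m2plus a2minus a2plus : ℝ) (ha : 0 < aminus)
    (ha2 : 0 < a2minus) (α : ℝ) (hα0 : 0 ≤ α) (hα1 : α < 1) :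
    ∃ δ M₀ C : ℝ, 0 < δ ∧ 0 < M₀ ∧ 0 < C ∧ ∀ (k : ℕ), 1 ≤ k → ∀ (aj m2 a : ℝ), aminus ≤ aj → aj ≤ aplus → 0 ≤ m2 →
      m2 ≤ m2plus → a2minus ≤ a → a ≤ a2plus → ∀ (Mh : ℕ), 3 ≤ Mh → M₀ ≤ ((ℓ : ℝ) + 1) * Mh →
        ∀ (P : Fin (d + 1) → ℕ), (∀ i, 1 ≤ P i) → ∀ (Λ : Finset ↥(boxDom (fun i => (ℓ + 1) * (Mh * P i)))),
        IsBlockUnion ℓ (fun i => Mh * P i) Λ → ∀ (μ : Fin (d + 1))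
        (x xe x' xe' : ↥(Box d ℓ k (fun i => (ℓ + 1) * (Mh * P i)))),
        xe.1 = x.1 + Pi.single μ 1 → xe'.1 = x'.1 + Pi.single μ 1 → x'.1 ≠ x.1 →
          wsum2 δ ((ℓ + 1) ^ k) x x' (fun z => ((((ℓ + 1) ^ k : ℕ) : ℝ) / supNorm (x'.1 - x.1)) ^ α
              * ((((ℓ + 1) ^ k : ℕ) : ℝ)
                * ((gTwoLevel ((ℓ + 1) ^ k) ℓ aj a m2 (fun i => Mh * P i) Λ xe' z
                    - gTwoLevel ((ℓ + 1) ^ k) ℓ aj a m2 (fun i => Mh * P i) Λ x' z)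
                  - (gTwoLevel ((ℓ + 1) ^ k) ℓ aj a m2 (fun i => Mh * P i) Λ xe z
                    - gTwoLevel ((ℓ + 1) ^ k) ℓ aj a m2 (fun i => Mh * P i) Λ x z)))) ≤ C := by
  obtain ⟨δ₁, CR, hδ₁, hCR, hR⟩ := roww_rOp_le d ℓ hℓ aminus aplus m2plus a2minus a2plus ha ha2
  obtain ⟨δ₃, C₀, hδ₃, hC₀, hG0⟩ :=
    wsum2_gZero_holder_le d ℓ hℓ aminus aplus m2plus a2minus a2plus ha ha2 α hα0 hα1
  refine ⟨min δ₁ δ₃, 2 * CR, 2 * C₀, lt_min hδ₁ hδ₃, by positivity, by positivity, ?_⟩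
  intro k hk aj m2 a e1 e2 e3 e4 e5 e6 Mh hMh hM P hP Λ hΛ μ x xe x' xe' hxe hxe' hne
  have hMh1 : 1 ≤ Mh := le_trans (by norm_num) hMh
  have hδ0 : 0 ≤ min δ₁ δ₃ := (lt_min hδ₁ hδ₃).le
  have hMpos : (0 : ℝ) < ((ℓ : ℝ) + 1) * Mh := by
    have : (3 : ℝ) ≤ Mh := by exact_mod_cast hMh
    have : (0 : ℝ) ≤ ℓ := Nat.cast_nonneg ℓ
    positivity
  set n : ℕ := (ℓ + 1) ^ k with hn
  set G := gTwoLevel ((ℓ + 1) ^ k) ℓ aj a m2 (fun i => Mh * P i) Λ with hG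
  set G₀ := B6Eq250.gZero (hDiag ℓ k Mh P) (gPad ℓ k Mh P aj a m2 Λ hP) with hG₀
  set Rm := B6Eq250.rOp (twoLevelOp ((ℓ + 1) ^ k) ℓ aj a m2 (fun i => Mh * P i) Λ) (hDiag ℓ k Mh P)
    (gPad ℓ k Mh P aj a m2 Λ hP) with hRm
  have hRrow : ∀ y, roww (min δ₁ δ₃) n Rm y ≤ 1 / 2 := by
    intro y
    refine (roww_mono (min_le_left _ _) _ _ _).trans ((hR k hk aj m2 a e1 e2 e3 e4 e5 e6 Mh hMh P hP Λ hΛ y).trans ?_)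
    calc CR / (((ℓ : ℝ) + 1) * Mh) ≤ CR / (2 * CR) := div_le_div_of_nonneg_left hCR.le (by positivity) hM
      _ = 1 / 2 := by field_simp
  have hfix : G = G₀ + G * Rm :=
    gTwoLevel_eq_gZero_add hℓ hk hMh1 hP (lt_of_lt_of_le ha e1) (lt_of_lt_of_le ha2 e5) e3 hΛ
  set W : ℝ := (((n : ℕ) : ℝ) / supNorm (x'.1 - x.1)) ^ α with hW
  -- the doubly differenced fixed point, entrywise
  have hent : ∀ z, W * ((n : ℝ) * ((G xe' z - G x' z) - (G xe z - G x z)))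
      = W * ((n : ℝ) * ((G₀ xe' z - G₀ x' z) - (G₀ xe z - G₀ x z)))
        + ∑ y, (W * ((n : ℝ) * ((G xe' y - G x' y) - (G xe y - G x y)))) * Rm y z := by
    intro z
    have e : ∀ y, G y z = G₀ y z + ∑ y', G y y' * Rm y' z := by
      intro y
      conv_lhs => rw [hfix]
      rw [Matrix.add_apply, Matrix.mul_apply]
    rw [e xe', e x', e xe, e x]
    have : ∑ y, (W * ((n : ℝ) * ((G xe' y - G x' y) - (G xe y - G x y)))) * Rm y z
        = W * ((n : ℝ) * ((∑ y, G xe' y * Rm y z - ∑ y, G x' y * Rm y z)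
          - (∑ y, G xe y * Rm y z - ∑ y, G x y * Rm y z))) := by
      rw [← Finset.sum_sub_distrib, ← Finset.sum_sub_distrib, ← Finset.sum_sub_distrib, Finset.mul_sum,
        Finset.mul_sum]
      exact Finset.sum_congr rfl fun y _ => by ring
    rw [this]
    ring
  set V := wsum2 (min δ₁ δ₃) n x x' (fun z => W * ((n : ℝ) * ((G xe' z - G x' z) - (G xe z - G x z)))) with hV
  have hVfix : V ≤ C₀ + V * (1 / 2) := by
    calc V = wsum2 (min δ₁ δ₃) n x x' (fun z => W * ((n : ℝ) * ((G₀ xe' z - G₀ x' z) - (G₀ xe z - G₀ x z)))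
          + ∑ y, (W * ((n : ℝ) * ((G xe' y - G x' y) - (G xe y - G x y)))) * Rm y z) := by
            rw [hV]; exact wsum2_congr _ _ _ _ hent
      _ ≤ wsum2 (min δ₁ δ₃) n x x' (fun z => W * ((n : ℝ) * ((G₀ xe' z - G₀ x' z) - (G₀ xe z - G₀ x z))))
          + wsum2 (min δ₁ δ₃) n x x' (fun z =>
              ∑ y, (W * ((n : ℝ) * ((G xe' y - G x' y) - (G xe y - G x y)))) * Rm y z) :=
            wsum2_add_le _ _ _ _ _ _
      _ ≤ C₀ + V * (1 / 2) :=
            add_le_add ((wsum2_mono_rate (min_le_right _ _) _ _ _ _).trans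
              (hG0 k hk aj m2 a e1 e2 e3 e4 e5 e6 Mh hMh P hP Λ μ x xe x' xe' hxe hxe' hne))
              (wsum2_vecMul_le hδ0 n x x' _ Rm hRrow)
  have hVle : V ≤ 2 * C₀ := by linarith
  exact hVle

/-- **THE PRINTED HÖLDER FORM OF (2.67)₄** (as [3] (1.9), with `‖λ‖_∞` and `dist({x,x′}, supp λ)`):
`(ξ|x′−x|_∞)^{−α}|((∂^ξ_μG′λ)(x′) − (∂^ξ_μG′λ)(x))| ≤ Ce^{−δξD}F` for every `λ` with `|λ| ≤ F` and every
`D ≤ min(|x−z|_∞, |x′−z|_∞)` on `supp λ` («‖ζ∇G′λ‖_α ≤ O(1)(L^jη)^{1−α}(…)e^{−½δ₀d(y,y′)}|λ|»), same uniformity.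
[cite: Balaban1984PropagatorsII, Proposition 2.2 (2.67) p.234; Balaban1983RegularityDecay, Theorem (1.9) p.573] -/
theorem gTwoLevel_holder_value_decay (d ℓ : ℕ) (hℓ : 1 ≤ ℓ) (aminus aplus m2plus a2minus a2plus : ℝ)
    (ha : 0 < aminus) (ha2 : 0 < a2minus) (α : ℝ) (hα0 : 0 ≤ α) (hα1 : α < 1) :
    ∃ δ M₀ C : ℝ, 0 < δ ∧ 0 < M₀ ∧ 0 < C ∧ ∀ (k : ℕ), 1 ≤ k → ∀ (aj m2 a : ℝ), aminus ≤ aj → aj ≤ aplus → 0 ≤ m2 →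
      m2 ≤ m2plus → a2minus ≤ a → a ≤ a2plus → ∀ (Mh : ℕ), 3 ≤ Mh → M₀ ≤ ((ℓ : ℝ) + 1) * Mh →
        ∀ (P : Fin (d + 1) → ℕ), (∀ i, 1 ≤ P i) → ∀ (Λ : Finset ↥(boxDom (fun i => (ℓ + 1) * (Mh * P i)))),
        IsBlockUnion ℓ (fun i => Mh * P i) Λ →
        ∀ (f : ↥(Box d ℓ k (fun i => (ℓ + 1) * (Mh * P i))) → ℝ) (F D : ℝ), (∀ z, |f z| ≤ F) →
        ∀ (μ : Fin (d + 1)) (x xe x' xe' : ↥(Box d ℓ k (fun i => (ℓ + 1) * (Mh * P i)))),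
        xe.1 = x.1 + Pi.single μ 1 → xe'.1 = x'.1 + Pi.single μ 1 → x'.1 ≠ x.1 →
        (∀ z, f z ≠ 0 → D ≤ min (supNorm (x.1 - z.1)) (supNorm (x'.1 - z.1))) →
          ((((ℓ + 1) ^ k : ℕ) : ℝ) / supNorm (x'.1 - x.1)) ^ α *
            |(((ℓ + 1) ^ k : ℕ) : ℝ) *
              ((((gTwoLevel ((ℓ + 1) ^ k) ℓ aj a m2 (fun i => Mh * P i) Λ) *ᵥ f) xe'
                  - ((gTwoLevel ((ℓ + 1) ^ k) ℓ aj a m2 (fun i => Mh * P i) Λ) *ᵥ f) x')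
                - (((gTwoLevel ((ℓ + 1) ^ k) ℓ aj a m2 (fun i => Mh * P i) Λ) *ᵥ f) xe
                  - ((gTwoLevel ((ℓ + 1) ^ k) ℓ aj a m2 (fun i => Mh * P i) Λ) *ᵥ f) x))|
            ≤ C * Real.exp (-(δ * D / (((ℓ + 1) ^ k : ℕ) : ℝ))) * F := by
  obtain ⟨δ, M₀, C, hδ, hM₀, hC, h⟩ :=
    prop22_entry4_twoLevelBox d ℓ hℓ aminus aplus m2plus a2minus a2plus ha ha2 α hα0 hα1
  refine ⟨δ, M₀, C, hδ, hM₀, hC, ?_⟩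
  intro k hk aj m2 a e1 e2 e3 e4 e5 e6 Mh hMh hM P hP Λ hΛ f F D hF μ x xe x' xe' hxe hxe' hne hD
  have hW0 : 0 ≤ ((((ℓ + 1) ^ k : ℕ) : ℝ) / supNorm (x'.1 - x.1)) ^ α :=
    Real.rpow_nonneg (div_nonneg (Nat.cast_nonneg _) (supNorm_nonneg _)) α
  rw [← abs_of_nonneg hW0, ← abs_mul, mulVec_dd]
  exact abs_sum_mul_le_of_wsum2 hδ.le _ x x' _
    (h k hk aj m2 a e1 e2 e3 e4 e5 e6 Mh hMh hM P hP Λ hΛ μ x xe x' xe' hxe hxe' hne) f hF hD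

end Prop22Holder

/-! ## §8 Non-vacuity -/

/-- the quantifier prefix of the fourth entry is inhabited: `d + 1 = 4`, `L = 2`, unit windows, `α = 1/2`.
[cite: Balaban1984PropagatorsII, Proposition 2.2 (2.67) p.234] -/
example : ∃ δ M₀ C : ℝ, 0 < δ ∧ 0 < M₀ ∧ 0 < C ∧ ∀ (k : ℕ), 1 ≤ k → ∀ (aj m2 a : ℝ), (1 : ℝ) ≤ aj → aj ≤ 1 →
      0 ≤ m2 → m2 ≤ 1 → (1 : ℝ) ≤ a → a ≤ 1 → ∀ (Mh : ℕ), 3 ≤ Mh → M₀ ≤ ((1 : ℕ) + 1 : ℝ) * Mh →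
        ∀ (P : Fin (3 + 1) → ℕ), (∀ i, 1 ≤ P i) → ∀ (Λ : Finset ↥(boxDom (fun i => (1 + 1) * (Mh * P i)))),
        IsBlockUnion 1 (fun i => Mh * P i) Λ → ∀ (μ : Fin (3 + 1))
        (x xe x' xe' : ↥(Box 3 1 k (fun i => (1 + 1) * (Mh * P i)))),
        xe.1 = x.1 + Pi.single μ 1 → xe'.1 = x'.1 + Pi.single μ 1 → x'.1 ≠ x.1 →
          wsum2 δ ((1 + 1) ^ k) x x' (fun z => ((((1 + 1) ^ k : ℕ) : ℝ) / supNorm (x'.1 - x.1)) ^ (1 / 2 : ℝ)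
              * ((((1 + 1) ^ k : ℕ) : ℝ)
                * ((gTwoLevel ((1 + 1) ^ k) 1 aj a m2 (fun i => Mh * P i) Λ xe' z
                    - gTwoLevel ((1 + 1) ^ k) 1 aj a m2 (fun i => Mh * P i) Λ x' z)
                  - (gTwoLevel ((1 + 1) ^ k) 1 aj a m2 (fun i => Mh * P i) Λ xe z
                    - gTwoLevel ((1 + 1) ^ k) 1 aj a m2 (fun i => Mh * P i) Λ x z)))) ≤ C := by
  have h := prop22_entry4_twoLevelBox 3 1 le_rfl 1 1 1 1 1 one_pos one_pos (1 / 2) (by norm_num) (by norm_num)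
  simpa using h

end

end Literature.MathematicalPhysics.QuantumFieldTheory.Balaban1983to89.B6Prop22HolderTwoLevelBox
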